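import Literature.Topology.FourManifolds.AttachmentBoundarySurgery
import Literature.Topology.FourManifolds.AttachmentBoundarySurgeryLink
import Literature.Topology.FourManifolds.ClosedBallCollarProofs
import Literature.Topology.FourManifolds.Cobordism
import Literature.Topology.FourManifolds.CollarNeck
import Literature.Topology.FourManifolds.DehnSurgery
import Literature.Topology.FourManifolds.DehnSurgeryTwistProofs
import Literature.Topology.FourManifolds.FreeFundamentalGroupThreeManifoldHempel
import Literature.Topology.FourManifolds.GluingProofs
import Literature.Topology.FourManifolds.HandleAttachingMapOfTube
import Literature.Topology.FourManifolds.HandleAttachingMapsExistence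
import Literature.Topology.FourManifolds.HandleTubeDepthField
import Literature.Topology.FourManifolds.ImmersionCriterion
import Literature.Topology.FourManifolds.KnotFraming
import Literature.Topology.FourManifolds.LickorishWallace
import Literature.Topology.FourManifolds.LinkSurgeryFramedUniqueness
import Literature.Topology.FourManifolds.LinkTubularNbhd
import Literature.Topology.FourManifolds.LinkTubularUniqueness
import Literature.Topology.FourManifolds.OneHandlebodyBoundarySum
import Literature.Topology.FourManifolds.OneHandlebodyBoundarySumProofs
import Literature.Topology.FourManifolds.PropertyRTraceBridgeOfPropertyRHolds
import Literature.Topology.FourManifolds.RLinkComponentsHomotopyBallSlice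
import Literature.Topology.FourManifolds.RLinkSphere
import Literature.Topology.FourManifolds.RLinkSphereHomotopySphereProofs
import Literature.Topology.FourManifolds.RadialDiffeomorph
import Literature.Topology.FourManifolds.SphereTwoProdCircleSumUniqueness
import Literature.Topology.FourManifolds.TubularNbhdConeTube
import Literature.Topology.FourManifolds.ZeroSphereSurgeryConnectedSum
import Mathlib.Analysis.SpecialFunctions.SmoothTransition
import HarnessLib

/-!
# `GompfScharlemannThompson2010_prop23` holds: every component of an R-link is slice in a homotopy 4-ball

Proofs only (no definitions, no named facts): the discharge of the named fact
`Literature.Topology.FourManifolds.GompfScharlemannThompson2010_prop23` of `RLinkComponentsHomotopyBallSlice.lean`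
(Gompf–Scharlemann–Thompson 2010, Prop. 2.3, attributed to Hillman; componentwise form): if surgery on a framed
`n`-component link `L ⊂ S³` yields `#ⁿ(S² × S¹)`, then every component of `L` is slice in a homotopy `4`-ball
(`Knot.IsHomotopyBallSlice`).

THE LINE (Kirby 1989, Ch. I §2, Lemma 2.1; GST 2010 §9). Close the trace `P = D⁴ ∪_L (2-handles)` — Kosinski's
simultaneous attachment along the RADIAL attaching maps of disjoint framed tubes (sections `FramedTubes`,
`AttachingMapOfTube`, `BoundarySurgery`) — with a `(1,n)`-handlebody `V` (`∂P` is the surgery on `L`,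
`≅ Y ≅ #ⁿ(S² × S¹) ≅ ∂V` by uniqueness of link surgery and of `#ⁿ(S² × S¹)`) to the R-link sphere `X = P ∪_φ V`,
a homotopy `4`-sphere (`IsRLinkSphere.nonempty_homotopyEquiv_sphere_holds`), and read the core of the `i`-th handle
in `X` (sections `Aux1`, `Aux2`, `CoreSliceDisc`): an `IsSliceDiscIn` datum, whence
`Knot.IsSliceDiscIn.isHomotopyBallSlice`. The `(1,n)`-handlebody input (Kirby's sentence «`∂(♮ⁿ S¹ × B³) =
#ⁿ S¹ × S²`») enters through the `S⁰`-surgery lemma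
`FramedSphereFamily.isConnectedSum_sphereTwoProdCircle_of_isSurgery_of_isOrientable` (`ZeroSphereSurgeryConnectedSum.lean`)
via `helper_crux_of_zeroSphereSurgery` (section `Reduction`).

PROVENANCE. The fact's docstring records that it «grounds
`Summit.SmoothPoincare4.SmoothPoincare4.Theses.VerlindeRLinks.VrlComponentsHBallSlice` (identical statement)»; that
route item is CLOSED Summits-side («proved by
`Summit.SmoothPoincare4.SmoothPoincare4.Theorems.VrlComponentsHBallSlice.KirbyLemma21.VrlComponentsHBallSlice_proof`»).
`Literature` cannot import `Summits`, so the proof — the eight files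
`Summits/SmoothPoincare4/SmoothPoincare4/Theorems/VerlindeRLinksVrlComponentsHBallSlice{StubCoreSliceDiscAux1,StubCoreSliceDiscAux2,StubCoreSliceDisc,StubFramedTubes,StubBoundarySurgery,StubAttachingMapOfTube,Reduction,}.lean`,
which use only Mathlib and `Literature.Topology.FourManifolds.*` — is carried over here verbatim, one `section` per
source file, as private helper lemmas in the sub-namespace `…FourManifolds.GompfScharlemannThompson2010Prop23`,
with the Theses decl replaced by the (syntactically identical) Literature `def`, and closed as
`GompfScharlemannThompson2010_prop23_holds`.

## References

* [GompfScharlemannThompson2010] R. E. Gompf, M. Scharlemann, A. Thompson, *Fibered knots and potential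
  counterexamples to the property 2R and slice-ribbon conjectures*, Geom. Topol. 14 (2010), 2305–2347: Prop. 2.3, §9.
* [Kirby1989] R. C. Kirby, *The Topology of 4-Manifolds*, LNM 1374 (1989), Ch. I §2 (p. 8), Lemma 2.1.
* [Kosinski1993] A. A. Kosinski, *Differential Manifolds* (1993), III §4, VI §6, §9.
* [GompfStipsicz1999] R. E. Gompf, A. I. Stipsicz, *4-Manifolds and Kirby Calculus* (1999), §5.3, Prop. 5.1.2.
-/

noncomputable section

namespace Literature.Topology.FourManifolds

namespace GompfScharlemannThompson2010Prop23

section Aux1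

/-! ### Source `Summits/SmoothPoincare4/SmoothPoincare4/Theorems/VerlindeRLinksVrlComponentsHBallSliceStubCoreSliceDiscAux1.lean` — radial cone discs in the 4-ball (core slice disc, auxiliary 1)

Original module docstring:

# Line `kirby-lemma21`, Stub 4 (`stub_core_isSliceDiscIn_of_isMultiAttachment`), auxiliary file 1:
# model-space calculus of the radial part of the core disc
(crux `VerlindeRLinks.VrlComponentsHBallSlice`, item stmt-SmoothPoincare4-15874)

The core of the `i`-th `2`-handle of `D⁴ ∪_L (2-handles)`, read in the `0`-handle `D⁴`, is the
cone `x ↦ σ(‖x‖²) · Kᵢ(x/‖x‖)` over the knot `Kᵢ ⊂ S³ = ∂D⁴`, for a radial profile `σ` with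
`σ(t) = 1 - t/4` on `t ≤ 5/4` (the value forced by Kosinski's gluing `x ∼ h̄ α x` of the handle
along the radial attaching map) and `0 < σ < 1` beyond.  This file supplies the pure calculus of
that cone, written as the cone tube `Knot.TubularNbhd.coneTube` (`TubularNbhdConeTube.lean`) of a
tube `ν` of the knot evaluated on the zero section after the planar radial reparametrisation
`radialMap (fun r => σ (r ^ 2))` (`RadialDiffeomorph.lean`):

* `helper_exists_discProfile` — the profile `σ` (one `Real.smoothTransition` splice);
* `injective_fderiv_radialMap` — a radial map `z ↦ φ(‖z‖) z/‖z‖` of an inner product space has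
  injective differential wherever `φ ≠ 0` and `φ' ≠ 0`;
* `coneDisc_*` — value `σ(‖x‖²) · K(x/‖x‖)`, norm `|σ(‖x‖²)|`, smoothness and injective
  differential off the origin, injectivity, and the value `σ 1 · K u` on the unit circle, of
  `x ↦ ν.coneTube (radialMap (fun r => σ (r ^ 2)) x, 0)`.

References: A. A. Kosinski, *Differential Manifolds* (1993), VI §6; R. C. Kirby, *The Topology of
4-Manifolds*, LNM 1374 (1989), Ch. I §2.
-/

open scoped _root_.Manifold _root_.ContDiff _root_.Topology
open _root_.Set _root_.Function _root_.Metric Literature.Topology.FourManifolds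

/-! ### The radial profile of the core disc -/

/-- **The radial profile** (helper stub `helper_exists_discProfile`): a smooth `σ : ℝ → ℝ` with
`σ t = 1 - t/4` for `t ≤ 5/4` and `0 < σ t < 1` for all `t > 0` (a `Real.smoothTransition`
splice of `1 - t/4` with the constant `11/16`). [folklore] -/
private theorem helper_exists_discProfile :
    ∃ σ : ℝ → ℝ, ContDiff ℝ ((⊤ : ℕ∞) : WithTop ℕ∞) σ ∧ (∀ t : ℝ, t ≤ 5 / 4 → σ t = 1 - t / 4) ∧
      ∀ t : ℝ, 0 < t → 0 < σ t ∧ σ t < 1 := by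
  refine ⟨fun t => 1 - (t + Real.smoothTransition (4 * t - 5) * (5 / 4 - t)) / 4, ?_, ?_, ?_⟩
  · have hχ : ContDiff ℝ ∞ fun t : ℝ => Real.smoothTransition (4 * t - 5) :=
      Real.smoothTransition.contDiff.comp ((contDiff_const.mul contDiff_id).sub contDiff_const)
    exact contDiff_const.sub
      ((contDiff_id.add (hχ.mul (contDiff_const.sub contDiff_id))).div_const _)
  · intro t ht
    have h0 : Real.smoothTransition (4 * t - 5) = 0 :=
      Real.smoothTransition.zero_of_nonpos (by linarith)
    simp only [h0, zero_mul, add_zero]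
  · intro t ht
    have h0 := Real.smoothTransition.nonneg (4 * t - 5)
    have h1 := Real.smoothTransition.le_one (4 * t - 5)
    rcases le_or_gt t (5 / 4) with hle | hgt
    · have hz : Real.smoothTransition (4 * t - 5) = 0 :=
        Real.smoothTransition.zero_of_nonpos (by linarith)
      simp only [hz, zero_mul, add_zero]
      constructor <;> linarith
    · rcases le_or_gt (3 / 2) t with hge | hlt
      · have ho : Real.smoothTransition (4 * t - 5) = 1 :=
          Real.smoothTransition.one_of_one_le (by linarith)
        simp only [ho, one_mul]
        constructor <;> linarith
      · constructor <;> nlinarith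

/-! ### Radial maps have injective differential off the origin -/

/-- **A radial map `z ↦ (φ ‖z‖ / ‖z‖) • z` has injective differential at `z ≠ 0` whenever
`φ ‖z‖ ≠ 0` and `φ' ‖z‖ ≠ 0`.**  By the product rule the differential is
`v ↦ (φ/r) v + c'(v) z` for some linear form `c'`, so its kernel lies on the line `ℝ z`, and along
the ray the derivative is `φ'(r) z ≠ 0`. [folklore] -/
private theorem injective_fderiv_radialMap {E : Type*} [NormedAddCommGroup E] [InnerProductSpace ℝ E]
    {φ : ℝ → ℝ} {φ' : ℝ} {z : E} (hz : z ≠ 0) (hφ : HasDerivAt φ φ' ‖z‖) (h0 : φ ‖z‖ ≠ 0)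
    (h1 : φ' ≠ 0) : Injective (fderiv ℝ (radialMap φ) z) := by
  have hr : ‖z‖ ≠ 0 := norm_ne_zero_iff.2 hz
  -- the scalar factor `c y = φ ‖y‖ / ‖y‖` is differentiable at `z`
  have hn : DifferentiableAt ℝ (fun y : E => ‖y‖) z := differentiableAt_id.norm ℝ hz
  have hc : DifferentiableAt ℝ (fun y : E => φ ‖y‖ * ‖y‖⁻¹) z :=
    (hφ.differentiableAt.comp z hn).mul (hn.inv hr)
  set c' : E →L[ℝ] ℝ := fderiv ℝ (fun y : E => φ ‖y‖ * ‖y‖⁻¹) z with hc'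
  set D : E →L[ℝ] E := (φ ‖z‖ * ‖z‖⁻¹) • ContinuousLinearMap.id ℝ E + c'.smulRight z
    with hDdef
  have hD : HasFDerivAt (radialMap φ : E → E) D z := hc.hasFDerivAt.smul (hasFDerivAt_id z)
  -- along the ray: `D z = φ' • z`
  have hray : D z = φ' • z := by
    have hA : HasDerivAt (fun t : ℝ => radialMap φ (t • z)) (D z) 1 := by
      have h2 : HasDerivAt (fun t : ℝ => t • z) z 1 := by
        simpa using (hasDerivAt_id (1 : ℝ)).smul_const z
      have hD1 : HasFDerivAt (radialMap φ : E → E) D ((1 : ℝ) • z) := by rwa [one_smul]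
      exact hD1.comp_hasDerivAt 1 h2
    have hB : HasDerivAt (fun t : ℝ => radialMap φ (t • z)) (φ' • z) 1 := by
      have hφ1 : HasDerivAt φ φ' (1 * ‖z‖) := by rwa [one_mul]
      have h4 : HasDerivAt (fun t : ℝ => φ (t * ‖z‖)) (φ' * ‖z‖) 1 := by
        have h5 := hφ1.comp (1 : ℝ) ((hasDerivAt_id (1 : ℝ)).mul_const ‖z‖)
        rw [one_mul] at h5
        exact h5
      have h3 : HasDerivAt (fun t : ℝ => (φ (t * ‖z‖) * ‖z‖⁻¹) • z)
          ((φ' * ‖z‖ * ‖z‖⁻¹) • z) 1 := (h4.mul_const ‖z‖⁻¹).smul_const z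
      rw [mul_inv_cancel_right₀ hr] at h3
      refine h3.congr_of_eventuallyEq ?_
      filter_upwards [Ioi_mem_nhds (zero_lt_one' ℝ)] with t ht
      have ht0 : (t : ℝ) ≠ 0 := (ne_of_gt ht)
      rw [radialMap, norm_smul, Real.norm_of_nonneg (le_of_lt ht), smul_smul]
      congr 1
      field_simp
    exact hA.unique hB
  -- injectivity
  rw [hD.fderiv]
  refine (injective_iff_map_eq_zero D).2 fun u hu => ?_
  have hcz : φ ‖z‖ * ‖z‖⁻¹ ≠ 0 := mul_ne_zero h0 (inv_ne_zero hr)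
  have hu' : (φ ‖z‖ * ‖z‖⁻¹) • u + c' u • z = 0 := by
    simpa [hDdef] using hu
  -- so `u` is a multiple of `z`
  have hu_eq : u = (-(c' u) * (φ ‖z‖ * ‖z‖⁻¹)⁻¹) • z := by
    have h5 : (φ ‖z‖ * ‖z‖⁻¹) • u = (-(c' u)) • z := by
      rw [neg_smul]; exact eq_neg_of_add_eq_zero_left hu'
    calc u = (φ ‖z‖ * ‖z‖⁻¹)⁻¹ • ((φ ‖z‖ * ‖z‖⁻¹) • u) := by
          rw [smul_smul, inv_mul_cancel₀ hcz, one_smul]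
      _ = (-(c' u) * (φ ‖z‖ * ‖z‖⁻¹)⁻¹) • z := by rw [h5, smul_smul, mul_comm]
  set a : ℝ := -(c' u) * (φ ‖z‖ * ‖z‖⁻¹)⁻¹ with ha_def
  have h6 : (a * φ') • z = 0 := by
    have h7 : D (a • z) = 0 := by rw [← hu_eq]; exact hu
    rwa [map_smul, hray, smul_smul] at h7
  have haz : a * φ' = 0 := by
    rcases smul_eq_zero.1 h6 with h | h
    · exact h
    · exact absurd h hz
  have ha : a = 0 := (mul_eq_zero.1 haz).resolve_right h1
  rw [hu_eq, ha, zero_smul]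

/-! ### The cone over the knot, reparametrised by `radialMap (σ ∘ (·)²)` -/

section ConeDisc

variable
  {K : Metric.sphere (0 : EuclideanSpace ℝ (Fin 2)) 1 →
    Metric.sphere (0 : EuclideanSpace ℝ (Fin 4)) 1}
  (ν : Knot.TubularNbhd K) (σ : ℝ → ℝ)

/-- **Value of the cone disc off the origin**: `σ(‖x‖²) · K(x/‖x‖)` (for `σ(‖x‖²) > 0`).
[cite: Kosinski1993, VI §6] -/
private theorem coneDisc_eq_smul {x : EuclideanSpace ℝ (Fin 2)} (hx : x ≠ 0) (h0 : 0 < σ (‖x‖ ^ 2)) :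
    ν.coneTube (radialMap (fun r => σ (r ^ 2)) x, 0) =
      σ (‖x‖ ^ 2) • (K (radialProjection (spherePt 1) x) : EuclideanSpace ℝ (Fin 4)) := by
  have hpos : 0 < σ (‖x‖ ^ 2) * ‖x‖⁻¹ := mul_pos h0 (inv_pos.2 (norm_pos_iff.2 hx))
  rw [radialMap, ν.coneTube_smul_fst hpos, ν.coneTube_fst_zero, smul_smul, mul_assoc,
    inv_mul_cancel₀ (norm_ne_zero_iff.2 hx), mul_one]

/-- On the unit circle the cone disc is `σ 1 · K u`. [cite: Kosinski1993, VI §6] -/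
private theorem coneDisc_coe_sphere (u : Metric.sphere (0 : EuclideanSpace ℝ (Fin 2)) 1) (h0 : 0 < σ 1) :
    ν.coneTube (radialMap (fun r => σ (r ^ 2)) (u : EuclideanSpace ℝ (Fin 2)), 0) =
      σ 1 • (K u : EuclideanSpace ℝ (Fin 4)) := by
  have h1 : ‖(u : EuclideanSpace ℝ (Fin 2))‖ ^ 2 = 1 := by rw [norm_eq_of_mem_sphere, one_pow]
  rw [coneDisc_eq_smul ν σ (ne_zero_of_mem_unit_sphere u) (by rwa [h1]), h1,
    radialProjection_coe_sphere]

/-- The cone disc at the origin is the junk value `0`. [folklore] -/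
private theorem coneDisc_zero :
    ν.coneTube (radialMap (fun r => σ (r ^ 2)) (0 : EuclideanSpace ℝ (Fin 2)), 0) = 0 := by
  rw [radialMap_zero, ν.coneTube_zero_fst]

/-- **Norm of the cone disc off the origin**: `|σ(‖x‖²)|`. [folklore] -/
private theorem norm_coneDisc {x : EuclideanSpace ℝ (Fin 2)} (hx : x ≠ 0) :
    ‖ν.coneTube (radialMap (fun r => σ (r ^ 2)) x, 0)‖ = |σ (‖x‖ ^ 2)| := by
  rw [ν.norm_coneTube, norm_radialMap _ hx]

/-- The cone disc lies in the open unit ball when `|σ| < 1` on `(0, ∞)`. [folklore] -/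
private theorem norm_coneDisc_lt_one (hσ : ∀ t : ℝ, 0 < t → |σ t| < 1) (x : EuclideanSpace ℝ (Fin 2)) :
    ‖ν.coneTube (radialMap (fun r => σ (r ^ 2)) x, 0)‖ < 1 := by
  rcases eq_or_ne x 0 with rfl | hx
  · rw [coneDisc_zero, norm_zero]; exact one_pos
  · rw [norm_coneDisc ν σ hx]; exact hσ _ (by positivity)

/-- The reparametrised point `radialMap (σ ∘ (·)²) x` is nonzero for `x ≠ 0`, `σ(‖x‖²) ≠ 0`.
[folklore] -/
private theorem radialMap_ne_zero {x : EuclideanSpace ℝ (Fin 2)} (hx : x ≠ 0) (h0 : σ (‖x‖ ^ 2) ≠ 0) :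
    radialMap (fun r => σ (r ^ 2)) x ≠ 0 := by
  rw [← norm_ne_zero_iff, norm_radialMap _ hx]
  exact abs_ne_zero.2 h0

/-- **The cone disc is `C^∞` off the origin** (where `σ` is `C^∞` and nonzero). [folklore] -/
private theorem contDiffAt_coneDisc {x : EuclideanSpace ℝ (Fin 2)} (hx : x ≠ 0)
    (hσ : ContDiffAt ℝ ((⊤ : ℕ∞) : WithTop ℕ∞) σ (‖x‖ ^ 2)) (h0 : σ (‖x‖ ^ 2) ≠ 0) :
    ContDiffAt ℝ ((⊤ : ℕ∞) : WithTop ℕ∞)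
      (fun y : EuclideanSpace ℝ (Fin 2) => ν.coneTube (radialMap (fun r => σ (r ^ 2)) y, 0))
      x := by
  have hsq : ContDiffAt ℝ ∞ (fun r : ℝ => r ^ 2) ‖x‖ := contDiffAt_id.pow 2
  have hψ : ContDiffAt ℝ ∞
      (radialMap (fun r => σ (r ^ 2)) : EuclideanSpace ℝ (Fin 2) → EuclideanSpace ℝ (Fin 2)) x :=
    contDiffAt_radialMap hx (hσ.comp (f := fun r : ℝ => r ^ 2) ‖x‖ hsq)
  have hq : (radialMap (fun r => σ (r ^ 2)) x, (0 : EuclideanSpace ℝ (Fin 2))).1 ≠ 0 :=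
    radialMap_ne_zero σ hx h0
  have hpair : ContDiffAt ℝ ∞ (fun y : EuclideanSpace ℝ (Fin 2) =>
      (radialMap (fun r => σ (r ^ 2)) y, (0 : EuclideanSpace ℝ (Fin 2)))) x :=
    hψ.prodMk contDiffAt_const
  exact (ν.contDiffAt_coneTube hq).comp (f := fun y : EuclideanSpace ℝ (Fin 2) =>
    (radialMap (fun r => σ (r ^ 2)) y, (0 : EuclideanSpace ℝ (Fin 2)))) x hpair

/-- **The cone disc has injective differential off the origin** where `σ ≠ 0` and `σ' ≠ 0`:
its differential is that of the cone tube (injective off the cocore,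
`Knot.TubularNbhd.injective_fderiv_coneTube`) composed with `v ↦ (dψ v, 0)`, `ψ` the planar
radial map, injective by `injective_fderiv_radialMap`. [folklore] -/
private theorem injective_fderiv_coneDisc {x : EuclideanSpace ℝ (Fin 2)} (hx : x ≠ 0) {σ' : ℝ}
    (hσ : ContDiffAt ℝ ((⊤ : ℕ∞) : WithTop ℕ∞) σ (‖x‖ ^ 2)) (hσ' : HasDerivAt σ σ' (‖x‖ ^ 2))
    (h0 : σ (‖x‖ ^ 2) ≠ 0) (h1 : σ' ≠ 0) :
    Injective (fderiv ℝ
      (fun y : EuclideanSpace ℝ (Fin 2) => ν.coneTube (radialMap (fun r => σ (r ^ 2)) y, 0))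
      x) := by
  set ψ : EuclideanSpace ℝ (Fin 2) → EuclideanSpace ℝ (Fin 2) := radialMap (fun r => σ (r ^ 2))
    with hψdef
  have hsq : ContDiffAt ℝ ∞ (fun r : ℝ => r ^ 2) ‖x‖ := contDiffAt_id.pow 2
  have hψd : DifferentiableAt ℝ ψ x :=
    (contDiffAt_radialMap hx (hσ.comp (f := fun r : ℝ => r ^ 2) ‖x‖ hsq)).differentiableAt
      (by simp)
  have hq : (ψ x, (0 : EuclideanSpace ℝ (Fin 2))).1 ≠ 0 := radialMap_ne_zero σ hx h0
  have hC : DifferentiableAt ℝ ν.coneTube (ψ x, 0) :=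
    (ν.contDiffAt_coneTube hq).differentiableAt (by simp)
  have hpair :
      HasFDerivAt (fun y : EuclideanSpace ℝ (Fin 2) => (ψ y, (0 : EuclideanSpace ℝ (Fin 2))))
        ((fderiv ℝ ψ x).prod 0) x :=
    hψd.hasFDerivAt.prodMk (hasFDerivAt_const (0 : EuclideanSpace ℝ (Fin 2)) x)
  have hcomp : HasFDerivAt
      (ν.coneTube ∘ fun y : EuclideanSpace ℝ (Fin 2) => (ψ y, (0 : EuclideanSpace ℝ (Fin 2))))
      ((fderiv ℝ ν.coneTube (ψ x, 0)).comp ((fderiv ℝ ψ x).prod 0)) x :=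
    hC.hasFDerivAt.comp x hpair
  have hfd : fderiv ℝ (fun y : EuclideanSpace ℝ (Fin 2) => ν.coneTube (ψ y, 0)) x =
      (fderiv ℝ ν.coneTube (ψ x, 0)).comp ((fderiv ℝ ψ x).prod 0) := hcomp.fderiv
  rw [hfd, ContinuousLinearMap.coe_comp]
  refine (ν.injective_fderiv_coneTube hq).comp ?_
  have h2 : HasDerivAt (fun r : ℝ => r ^ 2) (2 * ‖x‖) ‖x‖ := by
    simpa using hasDerivAt_pow 2 ‖x‖
  have hφ' : HasDerivAt (fun r : ℝ => σ (r ^ 2)) (σ' * (2 * ‖x‖)) ‖x‖ :=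
    hσ'.comp (h := fun r : ℝ => r ^ 2) ‖x‖ h2
  have hψinj : Injective (fderiv ℝ ψ x) :=
    injective_fderiv_radialMap hx hφ' h0
      (mul_ne_zero h1 (mul_ne_zero two_ne_zero (norm_ne_zero_iff.2 hx)))
  intro v w hvw
  exact hψinj (congrArg Prod.fst hvw)

/-- **Injectivity of the cone disc** on a region where `σ ∘ (·)²` separates norms: if two points
off the origin with `σ > 0` have the same image, and `σ(‖x‖²) = σ(‖x'‖²)` forces `‖x‖ = ‖x'‖`,
then `x = x'` (cone tube injective off the cocore, then compare norms and directions).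
[folklore] -/
private theorem eq_of_coneDisc_eq {x x' : EuclideanSpace ℝ (Fin 2)} (hx : x ≠ 0) (hx' : x' ≠ 0)
    (h0 : 0 < σ (‖x‖ ^ 2)) (h0' : 0 < σ (‖x'‖ ^ 2))
    (h : ν.coneTube (radialMap (fun r => σ (r ^ 2)) x, 0) =
      ν.coneTube (radialMap (fun r => σ (r ^ 2)) x', 0))
    (hmono : σ (‖x‖ ^ 2) = σ (‖x'‖ ^ 2) → ‖x‖ = ‖x'‖) : x = x' := by
  have hq : (radialMap (fun r => σ (r ^ 2)) x, (0 : EuclideanSpace ℝ (Fin 2))) ∈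
      {q : EuclideanSpace ℝ (Fin 2) × EuclideanSpace ℝ (Fin 2) | q.1 ≠ 0} :=
    radialMap_ne_zero σ hx h0.ne'
  have hq' : (radialMap (fun r => σ (r ^ 2)) x', (0 : EuclideanSpace ℝ (Fin 2))) ∈
      {q : EuclideanSpace ℝ (Fin 2) × EuclideanSpace ℝ (Fin 2) | q.1 ≠ 0} :=
    radialMap_ne_zero σ hx' h0'.ne'
  have hψ : radialMap (fun r => σ (r ^ 2)) x = radialMap (fun r => σ (r ^ 2)) x' :=
    congrArg Prod.fst (ν.injOn_coneTube hq hq' h)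
  have hn : σ (‖x‖ ^ 2) = σ (‖x'‖ ^ 2) := by
    have := congrArg norm hψ
    rwa [norm_radialMap _ hx, norm_radialMap _ hx', abs_of_pos h0, abs_of_pos h0'] at this
  have hr : ‖x‖ = ‖x'‖ := hmono hn
  rw [radialMap, radialMap, hn, hr] at hψ
  exact smul_right_injective _ (mul_ne_zero h0'.ne' (inv_ne_zero (norm_ne_zero_iff.2 hx'))) hψ

end ConeDisc

end Aux1

section Aux2

/-! ### Source `Summits/SmoothPoincare4/SmoothPoincare4/Theorems/VerlindeRLinksVrlComponentsHBallSliceStubCoreSliceDiscAux2.lean` — transport and gluing for the core slice disc (auxiliary 2)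

Original module docstring:

# Line `kirby-lemma21`, Stub 4 (`stub_core_isSliceDiscIn_of_isMultiAttachment`), auxiliary file 2:
# charts of `D⁴`, the shrunken `0`-handle, the handle-chart core and Kosinski's gluing on the core
(crux `VerlindeRLinks.VrlComponentsHBallSlice`, item stmt-SmoothPoincare4-15874)

The pieces of the core-disc datum `(e, f)` of a component `Kᵢ` in `P = D⁴ ∪_L (2-handles)`
(Kosinski's corner-free attachment `HandleAttachingMap.IsMultiAttachment g (𝓡∂ 4) P`, embeddings
`jA : D⁴ ∖ ⋃ cores ↪ P`, `jB i : D⁴ ∖ S ↪ P`) pushed into a boundaryless `X` along `j : P ↪ X`,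
that are statements about the closed ball `D⁴` and its open pieces:

* transport: a map `ℝᵏ → U` into an open piece `U ⊆ D⁴` which, as a map into `ℝ⁴`, is a given
  smooth (resp. immersive) map `F`, gives a smooth map (resp. with injective `mfderiv`)
  `ℝᵏ → X` after `jU : U ↪ P` and `j : P ↪ X` (`contMDiffAt_comp_opensBall`,
  `injective_mfderiv_comp_opensBall`);
* points of `D⁴` of norm `< 1` are off every core (`helper_mem_coresComplement_of_norm_lt_one`);
* the shrunken `0`-handle chart `y ↦ ballContraction (16 y)` (`RadialDiffeomorph.lean`): into the
  open unit ball, `𝔻⁴` into the ball of radius `3/4`, `= (3/4) ·` on `S³`, smooth, immersive, an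
  embedding; hence `e = j ∘ jA ∘ τ` is a smooth embedding `ℝ⁴ ↪ X` for any lift `τ` of it
  (`isSmoothEmbedding_ballChart`);
* the handle-chart core `x ↦ (ballContraction (32 x), 0) ∈ D⁴ ∖ S`, `= (x, 0)` for `‖x‖ < 1/4`;
* **the key computation** (`glueRel_cone_lamEmbed`): Kosinski's inversion `α` preserves `x_μ = 0`,
  so the punctured core point `(x, 0)`, `0 < ‖x‖ < 1`, of the handle is glued to the point
  `(1 - ‖x‖²/4) · K(x/‖x‖)` of `D⁴` when the attaching map is the radial one,
  `g y = (1 - depth(y)/4) · ν (angle y, fibre y)`; consequently a point of `D⁴` glued to the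
  handle-chart core point over `x` has `D⁴`-radius `1 - ‖x‖²/4` (`norm_of_jA_eq_jB`).

References: A. A. Kosinski, *Differential Manifolds* (1993), VI §6, (6.1); R. C. Kirby,
*The Topology of 4-Manifolds*, LNM 1374 (1989), Ch. I §2.
-/

open scoped _root_.Manifold _root_.ContDiff _root_.Topology
open _root_.Set _root_.Function _root_.Metric Literature.Topology.FourManifolds

/-! ### Transport of smoothness and immersivity through an open piece of `D⁴` -/

section Transport

variable {U : TopologicalSpace.Opens (Metric.closedBall (0 : EuclideanSpace ℝ (Fin 4)) 1)}
  {P : Type*} [TopologicalSpace P] [ChartedSpace (EuclideanHalfSpace 4) P]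
  {X : Type*} [TopologicalSpace X] [ChartedSpace (EuclideanSpace ℝ (Fin 4)) X] {k : ℕ}

/-- **Smoothness through an open piece of `D⁴`.**  If `φ : ℝᵏ → U` (`U ⊆ D⁴` open) agrees, as a
map into `ℝ⁴`, with a map `F` which is `C^∞` at `x`, and `jU : U → P`, `j : P → X` are `C^∞`, then
`y ↦ j (jU (φ y))` is `C^∞` at `x` (maps into `D⁴` are smooth when smooth into `ℝ⁴`,
`ContMDiffAt.codRestrict_closedBall`). [folklore] -/
private theorem contMDiffAt_comp_opensBall {jU : U → P}
    (hjU : ContMDiff (𝓡∂ 4) (𝓡∂ 4) ((⊤ : ℕ∞) : WithTop ℕ∞) jU) {j : P → X}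
    (hj : ContMDiff (𝓡∂ 4) (𝓡 4) ((⊤ : ℕ∞) : WithTop ℕ∞) j) {φ : EuclideanSpace ℝ (Fin k) → U}
    {F : EuclideanSpace ℝ (Fin k) → EuclideanSpace ℝ (Fin 4)}
    (hF : ∀ y, (φ y : EuclideanSpace ℝ (Fin 4)) = F y) {x : EuclideanSpace ℝ (Fin k)}
    (hFx : ContMDiffAt (𝓡 k) (𝓡 4) ((⊤ : ℕ∞) : WithTop ℕ∞) F x) :
    ContMDiffAt (𝓡 k) (𝓡 4) ((⊤ : ℕ∞) : WithTop ℕ∞) (fun y => j (jU (φ y))) x := by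
  have hφ : ContMDiffAt (𝓡 k) (𝓡 4) ∞ (fun y => (φ y : EuclideanSpace ℝ (Fin 4))) x :=
    hFx.congr_of_eventuallyEq (Filter.Eventually.of_forall hF)
  have h1 : ContMDiffAt (𝓡 k) (𝓡∂ 4) ∞ (Subtype.val ∘ φ) x :=
    hφ.codRestrict_closedBall (n := 3) (fun y => (φ y).1.2)
  have h2 : ContMDiffAt (𝓡 k) (𝓡∂ 4) ∞ φ x := (ContMDiffAt.subtypeVal_comp_iff U φ x).1 h1
  exact ((hj.comp hjU) (φ x)).comp x h2

/-- **Immersivity through an open piece of `D⁴`.**  If moreover `F` has injective differential at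
`x` and `jU`, `j` are smooth embeddings, then `y ↦ j (jU (φ y))` has injective `mfderiv` at `x`
(chain rule; immersions have injective differential, `Manifold.IsImmersionAt.mfderiv_injective`).
[folklore] -/
private theorem injective_mfderiv_comp_opensBall [IsManifold (𝓡∂ 4) ((⊤ : ℕ∞) : WithTop ℕ∞) P]
    [IsManifold (𝓡 4) ((⊤ : ℕ∞) : WithTop ℕ∞) X] {jU : U → P}
    (hjU : Manifold.IsSmoothEmbedding (𝓡∂ 4) (𝓡∂ 4) ((⊤ : ℕ∞) : WithTop ℕ∞) jU) {j : P → X}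
    (hj : Manifold.IsSmoothEmbedding (𝓡∂ 4) (𝓡 4) ((⊤ : ℕ∞) : WithTop ℕ∞) j)
    {φ : EuclideanSpace ℝ (Fin k) → U} {F : EuclideanSpace ℝ (Fin k) → EuclideanSpace ℝ (Fin 4)}
    (hF : ∀ y, (φ y : EuclideanSpace ℝ (Fin 4)) = F y) {x : EuclideanSpace ℝ (Fin k)}
    (hFx : ContMDiffAt (𝓡 k) (𝓡 4) ((⊤ : ℕ∞) : WithTop ℕ∞) F x)
    (hinj : Injective (mfderiv (𝓡 k) (𝓡 4) F x)) :
    Injective (mfderiv (𝓡 k) (𝓡 4) (fun y => j (jU (φ y))) x) := by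
  have hn : ((⊤ : ℕ∞) : WithTop ℕ∞) ≠ 0 := by simp
  have hfun : (fun y => (φ y : EuclideanSpace ℝ (Fin 4))) = F := funext hF
  have hφ : ContMDiffAt (𝓡 k) (𝓡 4) ∞ (fun y => (φ y : EuclideanSpace ℝ (Fin 4))) x := by
    rw [hfun]; exact hFx
  have hinj' : Injective (mfderiv (𝓡 k) (𝓡 4) (fun y => (φ y : EuclideanSpace ℝ (Fin 4))) x) := by
    rw [hfun]; exact hinj
  have h1 : ContMDiffAt (𝓡 k) (𝓡∂ 4) ∞ (Subtype.val ∘ φ) x :=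
    hφ.codRestrict_closedBall (n := 3) (fun y => (φ y).1.2)
  have h2 : ContMDiffAt (𝓡 k) (𝓡∂ 4) ∞ φ x := (ContMDiffAt.subtypeVal_comp_iff U φ x).1 h1
  have hφd : MDifferentiableAt (𝓡 k) (𝓡∂ 4) φ x := h2.mdifferentiableAt hn
  -- `mfderiv φ x` is injective: compose with the inclusion `U → ℝ⁴`
  have hval : ContMDiff (𝓡∂ 4) (𝓡 4) ∞ (fun u : U => (u : EuclideanSpace ℝ (Fin 4))) :=
    (contMDiff_coe_closedBall (n := 3)).comp contMDiff_subtype_val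
  have hvald : MDifferentiableAt (𝓡∂ 4) (𝓡 4) (fun u : U => (u : EuclideanSpace ℝ (Fin 4)))
      (φ x) := (hval _).mdifferentiableAt hn
  have hchain : mfderiv (𝓡 k) (𝓡 4) (fun y => (φ y : EuclideanSpace ℝ (Fin 4))) x =
      (mfderiv (𝓡∂ 4) (𝓡 4) (fun u : U => (u : EuclideanSpace ℝ (Fin 4))) (φ x)).comp
        (mfderiv (𝓡 k) (𝓡∂ 4) φ x) := mfderiv_comp x hvald hφd
  have hφinj : Injective (mfderiv (𝓡 k) (𝓡∂ 4) φ x) := by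
    rw [hchain, ContinuousLinearMap.coe_comp] at hinj'
    exact hinj'.of_comp
  -- the two embeddings have injective differentials
  have hjUd : MDifferentiableAt (𝓡∂ 4) (𝓡∂ 4) jU (φ x) :=
    (hjU.contMDiff _).mdifferentiableAt hn
  have hjd : MDifferentiableAt (𝓡∂ 4) (𝓡 4) j (jU (φ x)) := (hj.contMDiff _).mdifferentiableAt hn
  have hjUinj : Injective (mfderiv (𝓡∂ 4) (𝓡∂ 4) jU (φ x)) :=
    Manifold.IsImmersionAt.mfderiv_injective (hjU.isImmersion.isImmersionAt (φ x)) hn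
  have hjinj : Injective (mfderiv (𝓡∂ 4) (𝓡 4) j (jU (φ x))) :=
    Manifold.IsImmersionAt.mfderiv_injective (hj.isImmersion.isImmersionAt _) hn
  have hc1 : mfderiv (𝓡 k) (𝓡∂ 4) (fun y => jU (φ y)) x =
      (mfderiv (𝓡∂ 4) (𝓡∂ 4) jU (φ x)).comp (mfderiv (𝓡 k) (𝓡∂ 4) φ x) :=
    mfderiv_comp x hjUd hφd
  have hc2 : mfderiv (𝓡 k) (𝓡 4) (fun y => j (jU (φ y))) x =
      (mfderiv (𝓡∂ 4) (𝓡 4) j (jU (φ x))).comp (mfderiv (𝓡 k) (𝓡∂ 4) (fun y => jU (φ y)) x) :=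
    mfderiv_comp x hjd (hjUd.comp x hφd)
  rw [hc2, hc1, ContinuousLinearMap.coe_comp, ContinuousLinearMap.coe_comp]
  exact hjinj.comp (hjUinj.comp hφinj)

end Transport

/-! ### Points of `D⁴` off the cores -/

/-- **Points of `D⁴` of norm `< 1` lie off every attaching sphere** (helper stub
`helper_mem_coresComplement_of_norm_lt_one`): the cores lie in `∂D⁴ = {‖x‖ = 1}`
(`HandleAttachingMap.core_subset_boundary`, `boundary_closedBall`). [cite: Kosinski1993, VI §6] -/
private theorem helper_mem_coresComplement_of_norm_lt_one :
    ∀ (n : ℕ) (g : Fin n →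
      HandleAttachingMap 3 2 (Metric.closedBall (0 : EuclideanSpace ℝ (Fin 4)) 1))
      (a : Metric.closedBall (0 : EuclideanSpace ℝ (Fin 4)) 1),
      ‖(a : EuclideanSpace ℝ (Fin 4))‖ < 1 → a ∈ HandleAttachingMap.coresComplement g := by
  intro n g a ha
  rw [HandleAttachingMap.mem_coresComplement]
  intro i hi
  have hb : a ∈ (𝓡∂ 4).boundary (Metric.closedBall (0 : EuclideanSpace ℝ (Fin 4)) 1) :=
    (g i).core_subset_boundary hi
  have hb' : ‖(a : EuclideanSpace ℝ (Fin 4))‖ = 1 :=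
    (congrArg (fun s => a ∈ s) (boundary_closedBall 3)).mp hb
  exact ha.ne hb'

/-! ### The shrunken `0`-handle chart `y ↦ ballContraction (16 y)` -/

/-- The chart maps the closed unit ball into the ball of radius `3/4` (`ballProfile 16 = 3/4`,
monotonicity of the profile). [folklore] -/
private theorem norm_ballContraction_smul_le {y : EuclideanSpace ℝ (Fin 4)} (hy : ‖y‖ ≤ 1) :
    ‖ballContraction ((16 : ℝ) • y)‖ ≤ 3 / 4 := by
  rw [norm_ballContraction, ← ballProfile_sixteen]
  refine strictMono_ballProfile.monotone ?_
  rw [norm_smul, Real.norm_of_nonneg (by norm_num : (0 : ℝ) ≤ 16)]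
  nlinarith

/-- On the unit sphere the chart is the homothety of ratio `3/4`. [folklore] -/
private theorem ballContraction_smul_coe_sphere (u : Metric.sphere (0 : EuclideanSpace ℝ (Fin 4)) 1) :
    ballContraction ((16 : ℝ) • (u : EuclideanSpace ℝ (Fin 4))) =
      (3 / 4 : ℝ) • (u : EuclideanSpace ℝ (Fin 4)) := by
  rw [ballContraction_smul (norm_eq_of_mem_sphere u) (by norm_num : (0 : ℝ) < 16),
    ballProfile_sixteen]

/-- The chart is `C^∞`. [folklore] -/
private theorem contDiff_ballContraction_smul : ContDiff ℝ ((⊤ : ℕ∞) : WithTop ℕ∞)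
    (fun y : EuclideanSpace ℝ (Fin 4) => ballContraction ((16 : ℝ) • y)) :=
  contDiff_ballContraction.comp (contDiff_const_smul _)

/-- The chart has injective differential everywhere (it has the smooth left inverse
`w ↦ 16⁻¹ • ballContractionInv w` on the open unit ball). [folklore] -/
private theorem injective_mfderiv_ballContraction_smul (y : EuclideanSpace ℝ (Fin 4)) :
    Injective (mfderiv (𝓡 4) (𝓡 4)
      (fun y : EuclideanSpace ℝ (Fin 4) => ballContraction ((16 : ℝ) • y)) y) := by
  have hn : ((⊤ : ℕ∞) : WithTop ℕ∞) ≠ 0 := by simp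
  refine mfderiv_injective_of_eventuallyEq_leftInverse
    (g := fun w : EuclideanSpace ℝ (Fin 4) => (16 : ℝ)⁻¹ • ballContractionInv w) ?_ ?_ ?_
  · exact contDiff_ballContraction_smul.contDiffAt.contMDiffAt.mdifferentiableAt hn
  · have h : ContDiffAt ℝ ∞ (ballContractionInv : EuclideanSpace ℝ (Fin 4) → _)
        (ballContraction ((16 : ℝ) • y)) :=
      contDiffAt_ballContractionInv (norm_ballContraction_lt_one _)
    exact (h.const_smul (16 : ℝ)⁻¹).contMDiffAt.mdifferentiableAt hn
  · refine Filter.Eventually.of_forall fun w => ?_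
    simp only [comp_apply, ballContractionInv_ballContraction, smul_smul, id_eq]
    norm_num

/-- The chart is a topological embedding (the ball contraction is an open embedding and `16 •` a
homeomorphism). [folklore] -/
private theorem isEmbedding_ballContraction_smul :
    Topology.IsEmbedding (fun y : EuclideanSpace ℝ (Fin 4) => ballContraction ((16 : ℝ) • y)) :=
  ((ballContractionPartialHomeomorph (E := EuclideanSpace ℝ (Fin 4))).to_isOpenEmbedding
    rfl).isEmbedding.comp (Homeomorph.smulOfNeZero (16 : ℝ) (by norm_num)).isEmbedding

/-- **`e = j ∘ jA ∘ τ` is a smooth embedding `ℝ⁴ ↪ X`** for any lift `τ : ℝ⁴ → U` of the chart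
`y ↦ ballContraction (16 y)` to an open piece `U ⊆ D⁴` and smooth embeddings `jA : U ↪ P`,
`j : P ↪ X` (`X` boundaryless): smooth with injective differential everywhere, hence an immersion
(`isImmersion_of_injective_mfderiv`), and a composite of topological embeddings. [folklore] -/
private theorem isSmoothEmbedding_ballChart
    {U : TopologicalSpace.Opens (Metric.closedBall (0 : EuclideanSpace ℝ (Fin 4)) 1)}
    {P : Type*} [TopologicalSpace P] [ChartedSpace (EuclideanHalfSpace 4) P]
    [IsManifold (𝓡∂ 4) ((⊤ : ℕ∞) : WithTop ℕ∞) P] {X : Type*} [TopologicalSpace X]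
    [ChartedSpace (EuclideanSpace ℝ (Fin 4)) X] [IsManifold (𝓡 4) ((⊤ : ℕ∞) : WithTop ℕ∞) X]
    {jA : U → P} (hjA : Manifold.IsSmoothEmbedding (𝓡∂ 4) (𝓡∂ 4) ((⊤ : ℕ∞) : WithTop ℕ∞) jA)
    {j : P → X} (hj : Manifold.IsSmoothEmbedding (𝓡∂ 4) (𝓡 4) ((⊤ : ℕ∞) : WithTop ℕ∞) j)
    {τ : EuclideanSpace ℝ (Fin 4) → U}
    (hτ : ∀ y, (τ y : EuclideanSpace ℝ (Fin 4)) = ballContraction ((16 : ℝ) • y))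
    {e : EuclideanSpace ℝ (Fin 4) → X} (he : ∀ y, e y = j (jA (τ y))) :
    Manifold.IsSmoothEmbedding (𝓡 4) (𝓡 4) ((⊤ : ℕ∞) : WithTop ℕ∞) e := by
  have he' : e = fun y => j (jA (τ y)) := funext he
  rw [he']
  have hsm : ∀ y, ContMDiffAt (𝓡 4) (𝓡 4) ∞
      (fun y : EuclideanSpace ℝ (Fin 4) => ballContraction ((16 : ℝ) • y)) y :=
    fun y => contDiff_ballContraction_smul.contDiffAt.contMDiffAt
  refine ⟨isImmersion_of_injective_mfderiv (fun y => ?_) (by simp) (fun y => ?_), ?_⟩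
  · exact contMDiffAt_comp_opensBall hjA.contMDiff hj.contMDiff hτ (hsm y)
  · exact injective_mfderiv_comp_opensBall hjA hj hτ (hsm y)
      (injective_mfderiv_ballContraction_smul y)
  · have hval : Topology.IsEmbedding (fun a : U => (a : EuclideanSpace ℝ (Fin 4))) :=
      Topology.IsEmbedding.subtypeVal.comp Topology.IsEmbedding.subtypeVal
    have hτe : Topology.IsEmbedding τ := by
      rw [← hval.of_comp_iff]
      have hfun : (fun a : U => (a : EuclideanSpace ℝ (Fin 4))) ∘ τ =
          fun y => ballContraction ((16 : ℝ) • y) := funext hτ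
      rw [hfun]
      exact isEmbedding_ballContraction_smul
    exact hj.isEmbedding.comp (hjA.isEmbedding.comp hτe)

/-! ### The handle-chart core `x ↦ (ballContraction (32 x), 0)` -/

/-- For `‖x‖ < 1/4` the handle-chart core is `(x, 0)`. [folklore] -/
private theorem lamEmbed_ballContraction_smul_of_norm_lt {x : EuclideanSpace ℝ (Fin 2)} (hx : ‖x‖ < 4⁻¹) :
    lamEmbed (ballContraction ((32 : ℝ) • x)) = lamEmbed x := by
  have h8 : ‖(32 : ℝ) • x‖ < 8 := by
    rw [norm_smul, Real.norm_of_nonneg (by norm_num : (0 : ℝ) ≤ 32)]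
    nlinarith
  rw [ballContraction_eq_smul_of_norm_lt h8, smul_smul]
  norm_num

/-- The handle-chart core lies in the open unit ball. [folklore] -/
private theorem norm_lamEmbed_ballContraction_lt_one (x : EuclideanSpace ℝ (Fin 2)) :
    ‖lamEmbed (ballContraction ((32 : ℝ) • x))‖ < 1 := by
  rw [norm_lamEmbed]; exact norm_ballContraction_lt_one _

/-- `|x_λ|²` of a core-plane point `(u, 0)` is `‖u‖²`. [folklore] -/
private theorem lamSq_lamEmbed (u : EuclideanSpace ℝ (Fin 2)) : lamSq 2 (lamEmbed u) = ‖u‖ ^ 2 := by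
  rw [← norm_lamPart_sq, lamPart_lamEmbed]

/-- The handle-chart core lies off the attaching sphere `S = {|x_λ| = 1}`. [folklore] -/
private theorem lamSq_lamEmbed_ballContraction_ne_one (x : EuclideanSpace ℝ (Fin 2)) :
    lamSq 2 (lamEmbed (ballContraction ((32 : ℝ) • x))) ≠ 1 := by
  rw [lamSq_lamEmbed]
  have h := norm_ballContraction_lt_one ((32 : ℝ) • x)
  have h0 := norm_nonneg (ballContraction ((32 : ℝ) • x))
  nlinarith

/-- The handle-chart core is `C^∞`. [folklore] -/
private theorem contDiff_lamEmbed_ballContraction : ContDiff ℝ ((⊤ : ℕ∞) : WithTop ℕ∞)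
    (fun x : EuclideanSpace ℝ (Fin 2) => lamEmbed (ballContraction ((32 : ℝ) • x))) :=
  contDiff_lamEmbed.comp (contDiff_ballContraction.comp (contDiff_const_smul _))

/-- The handle-chart core has injective differential on `‖x‖ < 1/4` (left inverse `lamPart`).
[folklore] -/
private theorem injective_mfderiv_lamEmbed_ballContraction {x : EuclideanSpace ℝ (Fin 2)}
    (hx : ‖x‖ < 4⁻¹) :
    Injective (mfderiv (𝓡 2) (𝓡 4)
      (fun x : EuclideanSpace ℝ (Fin 2) => lamEmbed (ballContraction ((32 : ℝ) • x))) x) := by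
  have hn : ((⊤ : ℕ∞) : WithTop ℕ∞) ≠ 0 := by simp
  refine mfderiv_injective_of_eventuallyEq_leftInverse (g := lamPart) ?_ ?_ ?_
  · exact contDiff_lamEmbed_ballContraction.contDiffAt.contMDiffAt.mdifferentiableAt hn
  · exact contDiff_lamPart.contDiffAt.contMDiffAt.mdifferentiableAt hn
  · filter_upwards [(isOpen_lt continuous_norm continuous_const).mem_nhds hx] with y hy
    show lamPart (lamEmbed (ballContraction ((32 : ℝ) • y))) = y
    rw [lamEmbed_ballContraction_smul_of_norm_lt hy, lamPart_lamEmbed]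

/-! ### Kosinski's gluing on the punctured core -/

section Glue

variable {K : Metric.sphere (0 : EuclideanSpace ℝ (Fin 2)) 1 →
  Metric.sphere (0 : EuclideanSpace ℝ (Fin 4)) 1}

/-- **`α` on the core half-plane of the tube**: `α (√(1-s) θ, 0) = (√s θ, 0)`, i.e. Kosinski's
inversion of the tube point of angle `θ`, fibre `0` and depth `s < 1` is the core-plane point
`√s θ` (`α` is the block rescaling `handleInversion_eq_blockScale`, preserving `x_μ = 0`).
[cite: Kosinski1993, VI (6.1)] -/
private theorem handleInversion_mkVec_fibre_zero (θ : Metric.sphere (0 : EuclideanSpace ℝ (Fin 2)) 1)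
    {s : ℝ} (hs1 : s < 1) :
    handleInversion 2 (mkVec (θ : EuclideanSpace ℝ (Fin 2)) 0 s) =
      lamEmbed (Real.sqrt s • (θ : EuclideanSpace ℝ (Fin 2))) := by
  have hz : (1 : ℝ) - s - ‖(0 : EuclideanSpace ℝ (Fin 2))‖ ^ 2 = 1 - s := by rw [norm_zero]; ring
  have hpos : 0 < 1 - s - ‖(0 : EuclideanSpace ℝ (Fin 2))‖ ^ 2 := by rw [hz]; linarith
  have hL : lamSq 2 (mkVec (θ : EuclideanSpace ℝ (Fin 2)) 0 s) = 1 - s := by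
    rw [lamSq_mkVec θ 0 hpos.le, hz]
  have hr : 0 < Real.sqrt (1 - s) := Real.sqrt_pos.2 (by linarith)
  rw [handleInversion_eq_blockScale, hL, mkVec, hz, ← lamEmbed_smul,
    blockScale_lamEmbed_add_muEmbed, smul_zero, muEmbed_zero, add_zero, smul_smul,
    show (1 : ℝ) - (1 - s) = s by ring, div_mul_cancel₀ _ hr.ne']

/-- **The key computation: the punctured core of the handle is glued to the radial cone over the
knot.**  Let `h : T → D⁴` be the radial attaching map of a tube `ν` of `K`,
`h y = (1 - depth(y)/4) · ν (angle y, fibre y)`.  For `0 < ‖x‖ < 1` the core-plane point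
`b = (x, 0) ∈ D⁴ ∖ S` and the point `a = (1 - ‖x‖²/4) · K(x/‖x‖) ∈ D⁴` satisfy Kosinski's
relation `h.glueRel a b` (`a = h y`, `b = α y` for the tube point `y` of angle `x/‖x‖`, fibre `0`,
depth `‖x‖²`). [cite: Kosinski1993, VI §6] -/
private theorem glueRel_cone_lamEmbed
    (h : HandleAttachingMap 3 2 (Metric.closedBall (0 : EuclideanSpace ℝ (Fin 4)) 1))
    (ν : Knot.TubularNbhd K)
    (hg : ∀ y : ↥(handleTube 3 2), (h.toFun y : EuclideanSpace ℝ (Fin 4)) =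
      (1 - tubeDepth y / 4) • (ν (tubeAngle y, tubeFibre y) : EuclideanSpace ℝ (Fin 4)))
    {x : EuclideanSpace ℝ (Fin 2)} (hx0 : x ≠ 0) (hx1 : ‖x‖ < 1)
    {a b : Metric.closedBall (0 : EuclideanSpace ℝ (Fin 4)) 1}
    (ha : (a : EuclideanSpace ℝ (Fin 4)) =
      (1 - ‖x‖ ^ 2 / 4) • (K (radialProjection (spherePt 1) x) : EuclideanSpace ℝ (Fin 4)))
    (hb : (b : EuclideanSpace ℝ (Fin 4)) = lamEmbed x) : h.glueRel a b := by
  set u : Metric.sphere (0 : EuclideanSpace ℝ (Fin 2)) 1 := radialProjection (spherePt 1) x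
    with hu
  have hxpos : 0 < ‖x‖ := norm_pos_iff.2 hx0
  have hs : (0 : ℝ) ≤ ‖x‖ ^ 2 := by positivity
  have hlt : ‖x‖ ^ 2 < 1 := by nlinarith
  have h : 0 < 1 - ‖x‖ ^ 2 - ‖(0 : EuclideanSpace ℝ (Fin 2))‖ ^ 2 := by rw [norm_zero]; nlinarith
  refine ⟨mkTubePt u 0 (‖x‖ ^ 2) hs h, ?_, ?_, ?_⟩
  · show lamSq 2 (mkVec (u : EuclideanSpace ℝ (Fin 2)) 0 (‖x‖ ^ 2)) ≠ 1
    rw [lamSq_mkVec u 0 h.le, norm_zero]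
    nlinarith
  · show (b : EuclideanSpace ℝ (Fin 4)) =
      handleInversion 2 (mkVec (u : EuclideanSpace ℝ (Fin 2)) 0 (‖x‖ ^ 2))
    rw [hb, handleInversion_mkVec_fibre_zero u hlt, Real.sqrt_sq hxpos.le, hu,
      norm_smul_coe_radialProjection]
  · apply Subtype.ext
    rw [ha, hg, tubeDepth_mkTubePt, tubeAngle_mkTubePt, tubeFibre_mkTubePt, ν.coe_apply_zero]

/-- **A point of `D⁴` glued to the handle-chart core point over `x`, `‖x‖ < 1/4`, has
`D⁴`-radius `1 - ‖x‖²/4`** (and `x ≠ 0`: the belt-disc centre is unglued,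
`glueRel.lamSq_ne_zero`), for open pieces `jA : U → P`, `jB : D⁴ ∖ S → P` of `P` meeting along
Kosinski's relation of the radial attaching map `h`: by the key computation
`glueRel_cone_lamEmbed` and uniqueness of glued partners (`glueRel.left_unique`).
[cite: Kosinski1993, VI §6] -/
private theorem norm_of_jA_eq_jB
    (h : HandleAttachingMap 3 2 (Metric.closedBall (0 : EuclideanSpace ℝ (Fin 4)) 1))
    (ν : Knot.TubularNbhd K)
    (hg : ∀ y : ↥(handleTube 3 2), (h.toFun y : EuclideanSpace ℝ (Fin 4)) =
      (1 - tubeDepth y / 4) • (ν (tubeAngle y, tubeFibre y) : EuclideanSpace ℝ (Fin 4)))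
    {P : Type*} {U : TopologicalSpace.Opens (Metric.closedBall (0 : EuclideanSpace ℝ (Fin 4)) 1)}
    {jA : U → P} {jB : ↥(beltPiece 3 2) → P}
    (hglue : ∀ a b, jA a = jB b ↔ h.glueRel a b)
    {fB : EuclideanSpace ℝ (Fin 2) → ↥(beltPiece 3 2)}
    (hfB : ∀ x, (fB x : EuclideanSpace ℝ (Fin 4)) = lamEmbed (ballContraction ((32 : ℝ) • x)))
    {x : EuclideanSpace ℝ (Fin 2)} (hx : ‖x‖ < 4⁻¹) {a : U} (hab : jA a = jB (fB x)) :
    x ≠ 0 ∧ ‖(a : EuclideanSpace ℝ (Fin 4))‖ = 1 - ‖x‖ ^ 2 / 4 := by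
  have hrel : h.glueRel a (fB x) := (hglue a (fB x)).1 hab
  have hbx : (fB x : EuclideanSpace ℝ (Fin 4)) = lamEmbed x := by
    rw [hfB, lamEmbed_ballContraction_smul_of_norm_lt hx]
  have hx0 : x ≠ 0 := by
    intro hx0
    have h0 := hrel.lamSq_ne_zero
    rw [hbx, lamSq_lamEmbed, hx0, norm_zero] at h0
    exact h0 (by norm_num)
  have hx1 : ‖x‖ < 1 := hx.trans (by norm_num)
  set u : Metric.sphere (0 : EuclideanSpace ℝ (Fin 2)) 1 := radialProjection (spherePt 1) x
    with hu
  have hnn : 0 ≤ 1 - ‖x‖ ^ 2 / 4 := by nlinarith [norm_nonneg x]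
  have hnorm : ‖(1 - ‖x‖ ^ 2 / 4) • (K u : EuclideanSpace ℝ (Fin 4))‖ = 1 - ‖x‖ ^ 2 / 4 := by
    rw [norm_smul, norm_eq_of_mem_sphere, mul_one, Real.norm_of_nonneg hnn]
  have hmem : (1 - ‖x‖ ^ 2 / 4) • (K u : EuclideanSpace ℝ (Fin 4)) ∈
      Metric.closedBall (0 : EuclideanSpace ℝ (Fin 4)) 1 :=
    mem_closedBall_zero_iff.2 (by rw [hnorm]; nlinarith [norm_nonneg x])
  have hrel' : h.glueRel ⟨_, hmem⟩ (fB x) := glueRel_cone_lamEmbed h ν hg hx0 hx1 rfl hbx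
  have heq : (a : Metric.closedBall (0 : EuclideanSpace ℝ (Fin 4)) 1) = ⟨_, hmem⟩ :=
    hrel.left_unique hrel'
  refine ⟨hx0, ?_⟩
  rw [show (a : EuclideanSpace ℝ (Fin 4)) =
    ((a : Metric.closedBall (0 : EuclideanSpace ℝ (Fin 4)) 1) : EuclideanSpace ℝ (Fin 4))
    from rfl, heq]
  exact hnorm

end Glue

end Aux2

section CoreSliceDisc

/-! ### Source `Summits/SmoothPoincare4/SmoothPoincare4/Theorems/VerlindeRLinksVrlComponentsHBallSliceStubCoreSliceDisc.lean` — stub 4: the core of the i-th handle is a slice disc in the R-link sphere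

Original module docstring:

# Line `kirby-lemma21`, Stub 4 (`stub_core_isSliceDiscIn_of_isMultiAttachment`): in
# `D⁴ ∪_L (2-handles)` every component bounds the core of its `2`-handle, off a shrunken `0`-handle
(crux `VerlindeRLinks.VrlComponentsHBallSlice`, item stmt-SmoothPoincare4-15874)

This file proves the registered stub `stub_core_isSliceDiscIn_of_isMultiAttachment` (signature
verbatim from the lead's skeleton of line `kirby-lemma21`).  Let `2`-handles be attached to `D⁴`
(Kosinski's corner-free attachment, `HandleAttachingMap.IsMultiAttachment g (𝓡∂ 4) P`: smooth open
embeddings `jA : D⁴ ∖ ⋃ cores ↪ P`, `jB i : D⁴ ∖ S ↪ P` meeting along `x ∼ gᵢ α x`) along the RADIAL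
attaching maps `gᵢ y = (1 - depth(y)/4) · νᵢ (angle y, fibre y)` of tubes `νᵢ` of the components
`Kᵢ` of a framed link `L`, and let `j : P ↪ X` be a smooth embedding into a boundaryless smooth
`4`-manifold.  Then `Kᵢ` has a slice-disc datum `(e, f)` in `X` (`Knot.IsSliceDiscIn`):

* the ball `e = j ∘ jA ∘ τ`, `τ y = ballContraction (16 y)` (a radial embedding `ℝ⁴ ↪ B̊⁴`, equal to
  `(3/4) ·` on `S³`; `RadialDiffeomorph.lean`, auxiliary file 2);
* the disc `f`: for `‖x‖ < 1/4` the core of the handle read in the handle chart,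
  `f x = j (jB i (x, 0))`, and for `‖x‖ ≥ 1/4` the radial cone `f x = j (jA (σ(‖x‖²) · Kᵢ(x/‖x‖)))`
  with the profile `σ` of auxiliary file 1 (`σ(t) = 1 - t/4` on `t ≤ 5/4`).  The two formulas agree
  on `1/10 < ‖x‖ < 1/4` because Kosinski's inversion `α` preserves `x_μ = 0` and glues the punctured
  core point `(x, 0)` to `gᵢ (√(1-‖x‖²) x/‖x‖, 0) = (1 - ‖x‖²/4) · Kᵢ(x/‖x‖)`
  (`glueRel_cone_lamEmbed`, auxiliary file 2), so `f` is `C^∞`; it is an injective immersion on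
  `𝔻²`, its open disc misses `e(𝔻⁴)` (`D⁴`-radii `> 3/4` versus `≤ 3/4`, or the unglued belt-disc
  centre), and `f = e ∘ Kᵢ` on `S¹` (`σ 1 = 3/4 = ballProfile 16`).

The axioms are verified in §1 for abstract data `(h, ν, jA, jB, j, σ, fA, fB, τ, f, e)` pinned down
by their values in `ℝ⁴` (`isSliceDiscIn_of_coreDiscData`); §2 assembles the datum.

References: R. E. Gompf, M. Scharlemann, A. Thompson, *Fibered knots and potential counterexamples
to the Property 2R and Slice-Ribbon Conjectures*, Geom. Topol. 14 (2010), proof of Prop. 2.3;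
R. C. Kirby, *The Topology of 4-Manifolds*, LNM 1374 (1989), Ch. I §2; A. A. Kosinski,
*Differential Manifolds* (1993), VI §6.
-/

open scoped _root_.Manifold _root_.ContDiff _root_.Topology
open _root_.Set _root_.Function _root_.Metric Literature.Topology.FourManifolds

/-! ## §1 The core disc of a `2`-handle is a slice-disc datum (abstract data) -/

section CoreDisc

variable {K : Knot} (ν : Knot.TubularNbhd ⇑K) {σ : ℝ → ℝ} {P : Type*} {X : Type*}
  {U : TopologicalSpace.Opens (Metric.closedBall (0 : EuclideanSpace ℝ (Fin 4)) 1)}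
  {jA : U → P} {jB : ↥(beltPiece 3 2) → P} {j : P → X} {fA : EuclideanSpace ℝ (Fin 2) → U}
  {fB : EuclideanSpace ℝ (Fin 2) → ↥(beltPiece 3 2)} {τ : EuclideanSpace ℝ (Fin 4) → U}
  {f : EuclideanSpace ℝ (Fin 2) → X} {e : EuclideanSpace ℝ (Fin 4) → X}

/-- **On `1/10 < ‖x‖ < 1/4` the handle-chart core and the radial cone give the same point of `P`**:
`jB (x, 0) = jA (σ(‖x‖²) · K(x/‖x‖))`, `σ(‖x‖²) = 1 - ‖x‖²/4` (Kosinski's gluing along the radial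
attaching map, `glueRel_cone_lamEmbed`). [cite: Kosinski1993, VI §6] -/
private theorem jB_fB_eq_jA_fA
    (h : HandleAttachingMap 3 2 (Metric.closedBall (0 : EuclideanSpace ℝ (Fin 4)) 1))
    (hg : ∀ y : ↥(handleTube 3 2), (h.toFun y : EuclideanSpace ℝ (Fin 4)) =
      (1 - tubeDepth y / 4) • (ν (tubeAngle y, tubeFibre y) : EuclideanSpace ℝ (Fin 4)))
    (hglue : ∀ a b, jA a = jB b ↔ h.glueRel a b) (hσeq : ∀ t : ℝ, t ≤ 5 / 4 → σ t = 1 - t / 4)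
    (hfA : ∀ x, (fA x : EuclideanSpace ℝ (Fin 4)) =
      ν.coneTube (radialMap (fun r => σ (r ^ 2)) x, 0))
    (hfB : ∀ x, (fB x : EuclideanSpace ℝ (Fin 4)) = lamEmbed (ballContraction ((32 : ℝ) • x)))
    {x : EuclideanSpace ℝ (Fin 2)} (h1 : 10⁻¹ < ‖x‖) (h2 : ‖x‖ < 4⁻¹) : jB (fB x) = jA (fA x) := by
  symm
  rw [hglue]
  have hx0 : x ≠ 0 := fun h0 => by rw [h0, norm_zero] at h1; norm_num at h1
  have hx1 : ‖x‖ < 1 := h2.trans (by norm_num)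
  have ht : ‖x‖ ^ 2 ≤ 5 / 4 := by nlinarith
  have hσx : σ (‖x‖ ^ 2) = 1 - ‖x‖ ^ 2 / 4 := hσeq _ ht
  have hpos : 0 < σ (‖x‖ ^ 2) := by rw [hσx]; nlinarith
  refine glueRel_cone_lamEmbed h ν hg hx0 hx1 ?_ ?_
  · rw [hfA, coneDisc_eq_smul ν σ hx0 hpos, hσx]
  · rw [hfB, lamEmbed_ballContraction_smul_of_norm_lt h2]

/-- **Off the small disc `‖x‖ ≤ 1/10` the core disc is the radial formula** `f = j ∘ jA ∘ fA`.
[cite: Kosinski1993, VI §6] -/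
private theorem coreDisc_eq_radial
    (h : HandleAttachingMap 3 2 (Metric.closedBall (0 : EuclideanSpace ℝ (Fin 4)) 1))
    (hg : ∀ y : ↥(handleTube 3 2), (h.toFun y : EuclideanSpace ℝ (Fin 4)) =
      (1 - tubeDepth y / 4) • (ν (tubeAngle y, tubeFibre y) : EuclideanSpace ℝ (Fin 4)))
    (hglue : ∀ a b, jA a = jB b ↔ h.glueRel a b) (hσeq : ∀ t : ℝ, t ≤ 5 / 4 → σ t = 1 - t / 4)
    (hfA : ∀ x, (fA x : EuclideanSpace ℝ (Fin 4)) =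
      ν.coneTube (radialMap (fun r => σ (r ^ 2)) x, 0))
    (hfB : ∀ x, (fB x : EuclideanSpace ℝ (Fin 4)) = lamEmbed (ballContraction ((32 : ℝ) • x)))
    (hf1 : ∀ x, ‖x‖ < 4⁻¹ → f x = j (jB (fB x))) (hf2 : ∀ x, 4⁻¹ ≤ ‖x‖ → f x = j (jA (fA x)))
    {x : EuclideanSpace ℝ (Fin 2)} (hx : 10⁻¹ < ‖x‖) : f x = j (jA (fA x)) := by
  by_cases h4 : ‖x‖ < 4⁻¹
  · rw [hf1 x h4, jB_fB_eq_jA_fA ν h hg hglue hσeq hfA hfB hx h4]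
  · exact hf2 x (not_lt.1 h4)

/-- **The core disc is `C^∞`**: near a point with `‖x‖ < 1/4` it is `j ∘ jB ∘ fB` (handle chart,
smooth), near a point with `‖x‖ ≥ 1/4` it is `j ∘ jA ∘ fA` (radial cone, smooth off the origin).
[cite: GompfScharlemannThompson2010, proof of Prop. 2.3] -/
private theorem contMDiff_coreDisc [TopologicalSpace P] [ChartedSpace (EuclideanHalfSpace 4) P]
    [IsManifold (𝓡∂ 4) ((⊤ : ℕ∞) : WithTop ℕ∞) P] [TopologicalSpace X]
    [ChartedSpace (EuclideanSpace ℝ (Fin 4)) X] [IsManifold (𝓡 4) ((⊤ : ℕ∞) : WithTop ℕ∞) X]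
    (h : HandleAttachingMap 3 2 (Metric.closedBall (0 : EuclideanSpace ℝ (Fin 4)) 1))
    (hg : ∀ y : ↥(handleTube 3 2), (h.toFun y : EuclideanSpace ℝ (Fin 4)) =
      (1 - tubeDepth y / 4) • (ν (tubeAngle y, tubeFibre y) : EuclideanSpace ℝ (Fin 4)))
    (hjA : Manifold.IsSmoothEmbedding (𝓡∂ 4) (𝓡∂ 4) ((⊤ : ℕ∞) : WithTop ℕ∞) jA)
    (hjB : Manifold.IsSmoothEmbedding (𝓡∂ 4) (𝓡∂ 4) ((⊤ : ℕ∞) : WithTop ℕ∞) jB)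
    (hglue : ∀ a b, jA a = jB b ↔ h.glueRel a b)
    (hj : Manifold.IsSmoothEmbedding (𝓡∂ 4) (𝓡 4) ((⊤ : ℕ∞) : WithTop ℕ∞) j)
    (hσ : ContDiff ℝ ((⊤ : ℕ∞) : WithTop ℕ∞) σ) (hσeq : ∀ t : ℝ, t ≤ 5 / 4 → σ t = 1 - t / 4)
    (hσbd : ∀ t : ℝ, 0 < t → 0 < σ t ∧ σ t < 1)
    (hfA : ∀ x, (fA x : EuclideanSpace ℝ (Fin 4)) =
      ν.coneTube (radialMap (fun r => σ (r ^ 2)) x, 0))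
    (hfB : ∀ x, (fB x : EuclideanSpace ℝ (Fin 4)) = lamEmbed (ballContraction ((32 : ℝ) • x)))
    (hf1 : ∀ x, ‖x‖ < 4⁻¹ → f x = j (jB (fB x))) (hf2 : ∀ x, 4⁻¹ ≤ ‖x‖ → f x = j (jA (fA x))) :
    ContMDiff (𝓡 2) (𝓡 4) ((⊤ : ℕ∞) : WithTop ℕ∞) f := by
  intro x
  by_cases hx : ‖x‖ < 4⁻¹
  · have hev : f =ᶠ[𝓝 x] fun y => j (jB (fB y)) :=
      Filter.eventuallyEq_of_mem ((isOpen_lt continuous_norm continuous_const).mem_nhds hx)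
        fun y hy => hf1 y hy
    exact (contMDiffAt_comp_opensBall hjB.contMDiff hj.contMDiff hfB
      contDiff_lamEmbed_ballContraction.contDiffAt.contMDiffAt).congr_of_eventuallyEq hev
  · have hx' : 10⁻¹ < ‖x‖ := lt_of_lt_of_le (by norm_num) (not_lt.1 hx)
    have hev : f =ᶠ[𝓝 x] fun y => j (jA (fA y)) :=
      Filter.eventuallyEq_of_mem ((isOpen_lt continuous_const continuous_norm).mem_nhds hx')
        fun y hy => coreDisc_eq_radial ν h hg hglue hσeq hfA hfB hf1 hf2 hy
    have hx0 : x ≠ 0 := fun h0 => by rw [h0, norm_zero] at hx'; norm_num at hx'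
    exact (contMDiffAt_comp_opensBall hjA.contMDiff hj.contMDiff hfA
      (contDiffAt_coneDisc ν σ hx0 hσ.contDiffAt
        (hσbd _ (by positivity)).1.ne').contMDiffAt).congr_of_eventuallyEq hev

/-- **The core disc is an immersion on `𝔻²`**: the handle chart is immersive
(`injective_mfderiv_lamEmbed_ballContraction`), the radial cone is immersive for `‖x‖ ≤ 1` since
there `σ(t) = 1 - t/4` has `σ' = -1/4 ≠ 0` (`injective_fderiv_coneDisc`), and `jA`, `jB`, `j` are
smooth embeddings. [cite: GompfScharlemannThompson2010, proof of Prop. 2.3] -/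
private theorem injective_mfderiv_coreDisc [TopologicalSpace P] [ChartedSpace (EuclideanHalfSpace 4) P]
    [IsManifold (𝓡∂ 4) ((⊤ : ℕ∞) : WithTop ℕ∞) P] [TopologicalSpace X]
    [ChartedSpace (EuclideanSpace ℝ (Fin 4)) X] [IsManifold (𝓡 4) ((⊤ : ℕ∞) : WithTop ℕ∞) X]
    (h : HandleAttachingMap 3 2 (Metric.closedBall (0 : EuclideanSpace ℝ (Fin 4)) 1))
    (hg : ∀ y : ↥(handleTube 3 2), (h.toFun y : EuclideanSpace ℝ (Fin 4)) =
      (1 - tubeDepth y / 4) • (ν (tubeAngle y, tubeFibre y) : EuclideanSpace ℝ (Fin 4)))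
    (hjA : Manifold.IsSmoothEmbedding (𝓡∂ 4) (𝓡∂ 4) ((⊤ : ℕ∞) : WithTop ℕ∞) jA)
    (hjB : Manifold.IsSmoothEmbedding (𝓡∂ 4) (𝓡∂ 4) ((⊤ : ℕ∞) : WithTop ℕ∞) jB)
    (hglue : ∀ a b, jA a = jB b ↔ h.glueRel a b)
    (hj : Manifold.IsSmoothEmbedding (𝓡∂ 4) (𝓡 4) ((⊤ : ℕ∞) : WithTop ℕ∞) j)
    (hσ : ContDiff ℝ ((⊤ : ℕ∞) : WithTop ℕ∞) σ) (hσeq : ∀ t : ℝ, t ≤ 5 / 4 → σ t = 1 - t / 4)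
    (hfA : ∀ x, (fA x : EuclideanSpace ℝ (Fin 4)) =
      ν.coneTube (radialMap (fun r => σ (r ^ 2)) x, 0))
    (hfB : ∀ x, (fB x : EuclideanSpace ℝ (Fin 4)) = lamEmbed (ballContraction ((32 : ℝ) • x)))
    (hf1 : ∀ x, ‖x‖ < 4⁻¹ → f x = j (jB (fB x))) (hf2 : ∀ x, 4⁻¹ ≤ ‖x‖ → f x = j (jA (fA x)))
    {x : EuclideanSpace ℝ (Fin 2)} (hx1 : ‖x‖ ≤ 1) : Injective (mfderiv (𝓡 2) (𝓡 4) f x) := by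
  by_cases hx : ‖x‖ < 4⁻¹
  · have hev : f =ᶠ[𝓝 x] fun y => j (jB (fB y)) :=
      Filter.eventuallyEq_of_mem ((isOpen_lt continuous_norm continuous_const).mem_nhds hx)
        fun y hy => hf1 y hy
    rw [hev.mfderiv_eq]
    exact injective_mfderiv_comp_opensBall hjB hj hfB
      contDiff_lamEmbed_ballContraction.contDiffAt.contMDiffAt
      (injective_mfderiv_lamEmbed_ballContraction hx)
  · have hx' : 10⁻¹ < ‖x‖ := lt_of_lt_of_le (by norm_num) (not_lt.1 hx)
    have hev : f =ᶠ[𝓝 x] fun y => j (jA (fA y)) :=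
      Filter.eventuallyEq_of_mem ((isOpen_lt continuous_const continuous_norm).mem_nhds hx')
        fun y hy => coreDisc_eq_radial ν h hg hglue hσeq hfA hfB hf1 hf2 hy
    rw [hev.mfderiv_eq]
    have hx0 : x ≠ 0 := fun h0 => by rw [h0, norm_zero] at hx'; norm_num at hx'
    have hlt : ‖x‖ ^ 2 < 5 / 4 := by nlinarith
    have h0 : σ (‖x‖ ^ 2) ≠ 0 := by rw [hσeq _ hlt.le]; nlinarith
    have hev' : σ =ᶠ[𝓝 (‖x‖ ^ 2)] fun t => 1 - t / 4 :=
      Filter.eventuallyEq_of_mem (Iio_mem_nhds hlt) fun t ht => hσeq t (le_of_lt ht)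
    have hσ' : HasDerivAt σ (-(1 / 4)) (‖x‖ ^ 2) :=
      HasDerivAt.congr_of_eventuallyEq (((hasDerivAt_id (‖x‖ ^ 2)).div_const 4).const_sub 1) hev'
    refine injective_mfderiv_comp_opensBall hjA hj hfA
      (contDiffAt_coneDisc ν σ hx0 hσ.contDiffAt h0).contMDiffAt ?_
    rw [mfderiv_eq_fderiv]
    exact injective_fderiv_coneDisc ν σ hx0 hσ.contDiffAt hσ' h0 (by norm_num)

/-- **The core disc is injective on `𝔻²`**: two handle-chart points — `jB`, `j` injective and
`(x, 0) = (x', 0)`; two radial points — the cone is injective (`eq_of_coneDisc_eq`, `σ` strictly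
decreasing on `[0, 5/4]`); a handle-chart point is never a radial point, their `D⁴`-radii being
`> 1 - 1/64` and `≤ 1 - 1/64` (`norm_of_jA_eq_jB`).
[cite: GompfScharlemannThompson2010, proof of Prop. 2.3] -/
private theorem injOn_coreDisc
    (h : HandleAttachingMap 3 2 (Metric.closedBall (0 : EuclideanSpace ℝ (Fin 4)) 1))
    (hg : ∀ y : ↥(handleTube 3 2), (h.toFun y : EuclideanSpace ℝ (Fin 4)) =
      (1 - tubeDepth y / 4) • (ν (tubeAngle y, tubeFibre y) : EuclideanSpace ℝ (Fin 4)))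
    (hjA : Injective jA) (hjB : Injective jB) (hglue : ∀ a b, jA a = jB b ↔ h.glueRel a b)
    (hj : Injective j) (hσeq : ∀ t : ℝ, t ≤ 5 / 4 → σ t = 1 - t / 4)
    (hfA : ∀ x, (fA x : EuclideanSpace ℝ (Fin 4)) =
      ν.coneTube (radialMap (fun r => σ (r ^ 2)) x, 0))
    (hfB : ∀ x, (fB x : EuclideanSpace ℝ (Fin 4)) = lamEmbed (ballContraction ((32 : ℝ) • x)))
    (hf1 : ∀ x, ‖x‖ < 4⁻¹ → f x = j (jB (fB x))) (hf2 : ∀ x, 4⁻¹ ≤ ‖x‖ → f x = j (jA (fA x))) :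
    InjOn f (Metric.closedBall (0 : EuclideanSpace ℝ (Fin 2)) 1) := by
  -- the radial values have `σ(‖x‖²) = 1 - ‖x‖²/4`
  have hσx : ∀ x : EuclideanSpace ℝ (Fin 2), ‖x‖ ≤ 1 → σ (‖x‖ ^ 2) = 1 - ‖x‖ ^ 2 / 4 :=
    fun x hx => hσeq _ (by nlinarith [norm_nonneg x])
  have hnA : ∀ x : EuclideanSpace ℝ (Fin 2), x ≠ 0 → ‖x‖ ≤ 1 →
      ‖(fA x : EuclideanSpace ℝ (Fin 4))‖ = 1 - ‖x‖ ^ 2 / 4 := by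
    intro x hx0 hx
    rw [hfA, norm_coneDisc ν σ hx0, hσx x hx, abs_of_pos (by nlinarith [norm_nonneg x])]
  -- mixed case
  have hmixed : ∀ x x' : EuclideanSpace ℝ (Fin 2), ‖x‖ < 4⁻¹ → 4⁻¹ ≤ ‖x'‖ → ‖x'‖ ≤ 1 →
      f x ≠ f x' := by
    intro x x' hx hx' hx'1 hxx
    rw [hf1 x hx, hf2 x' hx'] at hxx
    have hx'0 : x' ≠ 0 := fun h0 => by rw [h0, norm_zero] at hx'; norm_num at hx'
    obtain ⟨-, hn⟩ := norm_of_jA_eq_jB h ν hg hglue hfB hx (hj hxx).symm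
    rw [hnA x' hx'0 hx'1] at hn
    nlinarith [norm_nonneg x, norm_nonneg x']
  intro x hx x' hx' hxx
  rw [mem_closedBall_zero_iff] at hx hx'
  by_cases h1 : ‖x‖ < 4⁻¹ <;> by_cases h2 : ‖x'‖ < 4⁻¹
  · rw [hf1 x h1, hf1 x' h2] at hxx
    have h3 := congrArg (fun b : ↥(beltPiece 3 2) => (b : EuclideanSpace ℝ (Fin 4))) (hjB (hj hxx))
    simp only [hfB, lamEmbed_ballContraction_smul_of_norm_lt h1,
      lamEmbed_ballContraction_smul_of_norm_lt h2] at h3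
    simpa using congrArg lamPart h3
  · exact absurd hxx (hmixed x x' h1 (not_lt.1 h2) hx')
  · exact absurd hxx.symm (hmixed x' x h2 (not_lt.1 h1) hx)
  · rw [hf2 x (not_lt.1 h1), hf2 x' (not_lt.1 h2)] at hxx
    have hx0 : x ≠ 0 := fun h0 => by rw [h0, norm_zero] at h1; norm_num at h1
    have hx'0 : x' ≠ 0 := fun h0 => by rw [h0, norm_zero] at h2; norm_num at h2
    have h3 := congrArg (fun a : U => (a : EuclideanSpace ℝ (Fin 4))) (hjA (hj hxx))
    simp only [hfA] at h3
    refine eq_of_coneDisc_eq ν σ hx0 hx'0 (by rw [hσx x hx]; nlinarith)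
      (by rw [hσx x' hx']; nlinarith) h3 fun hs => ?_
    rw [hσx x hx, hσx x' hx'] at hs
    have hsq : ‖x‖ ^ 2 = ‖x'‖ ^ 2 := by linarith
    exact (sq_eq_sq₀ (norm_nonneg x) (norm_nonneg x')).1 hsq

/-- **Properness: the open core disc misses the shrunken `0`-handle `e(𝔻⁴) = j (jA (τ 𝔻⁴))`**,
whose points have `D⁴`-radius `≤ 3/4` (`norm_ballContraction_smul_le`): a radial point of the open
disc has radius `σ(‖x‖²) = 1 - ‖x‖²/4 > 3/4`, and a handle-chart point is glued only to a point of
radius `1 - ‖x‖²/4 > 3/4` (`norm_of_jA_eq_jB`).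
[cite: GompfScharlemannThompson2010, proof of Prop. 2.3] -/
private theorem coreDisc_notMem
    (h : HandleAttachingMap 3 2 (Metric.closedBall (0 : EuclideanSpace ℝ (Fin 4)) 1))
    (hg : ∀ y : ↥(handleTube 3 2), (h.toFun y : EuclideanSpace ℝ (Fin 4)) =
      (1 - tubeDepth y / 4) • (ν (tubeAngle y, tubeFibre y) : EuclideanSpace ℝ (Fin 4)))
    (hjA : Injective jA) (hglue : ∀ a b, jA a = jB b ↔ h.glueRel a b) (hj : Injective j)
    (hσeq : ∀ t : ℝ, t ≤ 5 / 4 → σ t = 1 - t / 4)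
    (hfA : ∀ x, (fA x : EuclideanSpace ℝ (Fin 4)) =
      ν.coneTube (radialMap (fun r => σ (r ^ 2)) x, 0))
    (hfB : ∀ x, (fB x : EuclideanSpace ℝ (Fin 4)) = lamEmbed (ballContraction ((32 : ℝ) • x)))
    (hτ : ∀ y, (τ y : EuclideanSpace ℝ (Fin 4)) = ballContraction ((16 : ℝ) • y))
    (hf1 : ∀ x, ‖x‖ < 4⁻¹ → f x = j (jB (fB x))) (hf2 : ∀ x, 4⁻¹ ≤ ‖x‖ → f x = j (jA (fA x)))
    (he : ∀ y, e y = j (jA (τ y))) {x : EuclideanSpace ℝ (Fin 2)} (hx : ‖x‖ < 1) :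
    f x ∉ e '' Metric.closedBall (0 : EuclideanSpace ℝ (Fin 4)) 1 := by
  rintro ⟨y, hy, hxy⟩
  rw [mem_closedBall_zero_iff] at hy
  rw [he] at hxy
  have hτy : ‖(τ y : EuclideanSpace ℝ (Fin 4))‖ ≤ 3 / 4 := by
    rw [hτ]; exact norm_ballContraction_smul_le hy
  by_cases h1 : ‖x‖ < 4⁻¹
  · rw [hf1 x h1] at hxy
    obtain ⟨-, hn⟩ := norm_of_jA_eq_jB h ν hg hglue hfB h1 (hj hxy)
    rw [hn] at hτy
    nlinarith [norm_nonneg x]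
  · rw [hf2 x (not_lt.1 h1)] at hxy
    have hx0 : x ≠ 0 := fun h0 => by rw [h0, norm_zero] at h1; norm_num at h1
    have heq : τ y = fA x := hjA (hj hxy)
    have hn : ‖(fA x : EuclideanSpace ℝ (Fin 4))‖ = 1 - ‖x‖ ^ 2 / 4 := by
      rw [hfA, norm_coneDisc ν σ hx0, hσeq _ (by nlinarith), abs_of_pos (by nlinarith)]
    rw [heq, hn] at hτy
    nlinarith [norm_nonneg x]

/-- **Boundary values: `f = e ∘ K` on `S¹`**: `f u = j (jA (σ 1 · K u))` with `σ 1 = 3/4`, and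
`e (K u) = j (jA (ballContraction (16 K u))) = j (jA ((3/4) · K u))` (`ballProfile 16 = 3/4`).
[cite: GompfScharlemannThompson2010, proof of Prop. 2.3] -/
private theorem coreDisc_coe_sphere (hσeq : ∀ t : ℝ, t ≤ 5 / 4 → σ t = 1 - t / 4)
    (hfA : ∀ x, (fA x : EuclideanSpace ℝ (Fin 4)) =
      ν.coneTube (radialMap (fun r => σ (r ^ 2)) x, 0))
    (hτ : ∀ y, (τ y : EuclideanSpace ℝ (Fin 4)) = ballContraction ((16 : ℝ) • y))
    (hf2 : ∀ x, 4⁻¹ ≤ ‖x‖ → f x = j (jA (fA x))) (he : ∀ y, e y = j (jA (τ y)))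
    (u : Metric.sphere (0 : EuclideanSpace ℝ (Fin 2)) 1) : f u = e (K u) := by
  have hu : ‖(u : EuclideanSpace ℝ (Fin 2))‖ = 1 := norm_eq_of_mem_sphere u
  have hσ1 : σ 1 = 3 / 4 := by rw [hσeq 1 (by norm_num)]; norm_num
  rw [hf2 _ (by rw [hu]; norm_num), he]
  congr 2
  apply Subtype.ext
  apply Subtype.ext
  show (fA u : EuclideanSpace ℝ (Fin 4)) = (τ (K u) : EuclideanSpace ℝ (Fin 4))
  rw [hfA, hτ, coneDisc_coe_sphere ν σ u (by rw [hσ1]; norm_num), hσ1,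
    ballContraction_smul_coe_sphere]

/-- **The core of the `2`-handle is a slice-disc datum** (abstract form of stub 4): for the radial
attaching map `h` of a tube `ν` of `K`, smooth embeddings `jA : U ↪ P` (`U ⊆ D⁴` open),
`jB : D⁴ ∖ S ↪ P` meeting along Kosinski's relation, `j : P ↪ X` into a boundaryless `4`-manifold,
the profile `σ`, and maps `fA`, `fB`, `τ`, `f`, `e` with the prescribed values,
`K.IsSliceDiscIn X e f`: `e` is a smoothly embedded ball (`isSmoothEmbedding_ballChart`) and `f` a
`C^∞` map, an injective immersion on `𝔻²` whose open disc misses `e(𝔻⁴)`, with `f = e ∘ K` on `S¹`.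
[cite: GompfScharlemannThompson2010, proof of Prop. 2.3] -/
private theorem isSliceDiscIn_of_coreDiscData [TopologicalSpace P] [ChartedSpace (EuclideanHalfSpace 4) P]
    [IsManifold (𝓡∂ 4) ((⊤ : ℕ∞) : WithTop ℕ∞) P] [TopologicalSpace X]
    [ChartedSpace (EuclideanSpace ℝ (Fin 4)) X] [IsManifold (𝓡 4) ((⊤ : ℕ∞) : WithTop ℕ∞) X]
    (h : HandleAttachingMap 3 2 (Metric.closedBall (0 : EuclideanSpace ℝ (Fin 4)) 1))
    (hg : ∀ y : ↥(handleTube 3 2), (h.toFun y : EuclideanSpace ℝ (Fin 4)) =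
      (1 - tubeDepth y / 4) • (ν (tubeAngle y, tubeFibre y) : EuclideanSpace ℝ (Fin 4)))
    (hjA : Manifold.IsSmoothEmbedding (𝓡∂ 4) (𝓡∂ 4) ((⊤ : ℕ∞) : WithTop ℕ∞) jA)
    (hjB : Manifold.IsSmoothEmbedding (𝓡∂ 4) (𝓡∂ 4) ((⊤ : ℕ∞) : WithTop ℕ∞) jB)
    (hglue : ∀ a b, jA a = jB b ↔ h.glueRel a b)
    (hj : Manifold.IsSmoothEmbedding (𝓡∂ 4) (𝓡 4) ((⊤ : ℕ∞) : WithTop ℕ∞) j)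
    (hσ : ContDiff ℝ ((⊤ : ℕ∞) : WithTop ℕ∞) σ) (hσeq : ∀ t : ℝ, t ≤ 5 / 4 → σ t = 1 - t / 4)
    (hσbd : ∀ t : ℝ, 0 < t → 0 < σ t ∧ σ t < 1)
    (hfA : ∀ x, (fA x : EuclideanSpace ℝ (Fin 4)) =
      ν.coneTube (radialMap (fun r => σ (r ^ 2)) x, 0))
    (hfB : ∀ x, (fB x : EuclideanSpace ℝ (Fin 4)) = lamEmbed (ballContraction ((32 : ℝ) • x)))
    (hτ : ∀ y, (τ y : EuclideanSpace ℝ (Fin 4)) = ballContraction ((16 : ℝ) • y))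
    (hf1 : ∀ x, ‖x‖ < 4⁻¹ → f x = j (jB (fB x))) (hf2 : ∀ x, 4⁻¹ ≤ ‖x‖ → f x = j (jA (fA x)))
    (he : ∀ y, e y = j (jA (τ y))) : K.IsSliceDiscIn X e f := by
  have hjAi : Injective jA := hjA.isEmbedding.injective
  have hjBi : Injective jB := hjB.isEmbedding.injective
  have hji : Injective j := hj.isEmbedding.injective
  exact ⟨isSmoothEmbedding_ballChart hjA hj hτ he,
    contMDiff_coreDisc ν h hg hjA hjB hglue hj hσ hσeq hσbd hfA hfB hf1 hf2,
    injOn_coreDisc ν h hg hjAi hjBi hglue hji hσeq hfA hfB hf1 hf2,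
    fun x hx => injective_mfderiv_coreDisc ν h hg hjA hjB hglue hj hσ hσeq hfA hfB hf1 hf2
      (mem_closedBall_zero_iff.1 hx),
    fun x hx => coreDisc_notMem ν h hg hjAi hglue hji hσeq hfA hfB hτ hf1 hf2 he hx,
    coreDisc_coe_sphere ν hσeq hfA hτ hf2 he⟩

end CoreDisc

/-! ## §2 The registered stub -/

/-- **Stub 4 of line `kirby-lemma21` — in `D⁴ ∪ (2-handles)` every component bounds the core of its
`2`-handle, off a shrunken `0`-handle** (`stub_core_isSliceDiscIn_of_isMultiAttachment`, registered
signature verbatim).  With the `2`-handles attached to `D⁴` along the radial attaching maps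
`gᵢ y = (1 - depth(y)/4) · νᵢ (angle y, fibre y)` of tubes of the components of `L`
(`HandleAttachingMap.IsMultiAttachment g (𝓡∂ 4) P`) and `j : P ↪ X` a smooth embedding into a
boundaryless smooth `4`-manifold, every component `L.component i` has a slice-disc datum
`(e, f)` in `X`: `e = j ∘ jA ∘ (y ↦ ballContraction (16 y))` and `f` the core of the `i`-th handle,
`j (jB i (ballContraction (32 x), 0))` for `‖x‖ < 1/4` continued by the radial cone
`j (jA (σ(‖x‖²) · Kᵢ(x/‖x‖)))` (`isSliceDiscIn_of_coreDiscData`).  Gompf–Scharlemann–Thompson,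
proof of Prop. 2.3: "the cores of the original `n` `2`-handles … are the required `n` `2`-disks".
[cite: GompfScharlemannThompson2010, proof of Prop. 2.3] [cite: Kosinski1993, VI §6] -/
private theorem stub_core_isSliceDiscIn_of_isMultiAttachment :
    ∀ (n : ℕ) (L : FramedLink (Fin n))
      (g : Fin n → HandleAttachingMap 3 2 (Metric.closedBall (0 : EuclideanSpace ℝ (Fin 4)) 1))
      (ν : ∀ i, Knot.TubularNbhd ⇑(L.component i)),
      (∀ (i : Fin n) (y : ↥(handleTube 3 2)),
        (((g i).toFun y : Metric.closedBall (0 : EuclideanSpace ℝ (Fin 4)) 1) : EuclideanSpace ℝ (Fin 4)) =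
          (1 - tubeDepth y / 4) •
            ((ν i (tubeAngle y, tubeFibre y) : Metric.sphere (0 : EuclideanSpace ℝ (Fin 4)) 1) :
              EuclideanSpace ℝ (Fin 4))) →
      ∀ (P : Type) [TopologicalSpace P] [T2Space P] [ChartedSpace (EuclideanHalfSpace 4) P]
        [IsManifold (𝓡∂ 4) ((⊤ : ℕ∞) : WithTop ℕ∞) P],
        HandleAttachingMap.IsMultiAttachment g (𝓡∂ 4) P →
        ∀ (X : Type) [TopologicalSpace X] [T2Space X] [ChartedSpace (EuclideanSpace ℝ (Fin 4)) X]
          [IsManifold (𝓡 4) ((⊤ : ℕ∞) : WithTop ℕ∞) X] (j : P → X),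
          Manifold.IsSmoothEmbedding (𝓡∂ 4) (𝓡 4) ((⊤ : ℕ∞) : WithTop ℕ∞) j →
          ∀ i : Fin n, ∃ (e : EuclideanSpace ℝ (Fin 4) → X) (f : EuclideanSpace ℝ (Fin 2) → X),
            (L.component i).IsSliceDiscIn X e f := by
  intro n L g ν hg P _ _ _ _ hP X _ _ _ _ j hj i
  obtain ⟨-, jA, jB, hjA, -, hjB, -, hglue, -⟩ := hP
  obtain ⟨σ, hσ, hσeq, hσbd⟩ := helper_exists_discProfile
  have hσabs : ∀ t : ℝ, 0 < t → |σ t| < 1 := fun t ht => by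
    rw [abs_of_pos (hσbd t ht).1]; exact (hσbd t ht).2
  -- the radial cone over `Kᵢ`, into `D⁴ ∖ ⋃ cores`
  have hA1 : ∀ x : EuclideanSpace ℝ (Fin 2),
      (ν i).coneTube (radialMap (fun r => σ (r ^ 2)) x, 0) ∈
        Metric.closedBall (0 : EuclideanSpace ℝ (Fin 4)) 1 := fun x =>
    mem_closedBall_zero_iff.2 (norm_coneDisc_lt_one (ν i) σ hσabs x).le
  have hA2 : ∀ x : EuclideanSpace ℝ (Fin 2),
      (⟨_, hA1 x⟩ : Metric.closedBall (0 : EuclideanSpace ℝ (Fin 4)) 1) ∈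
        HandleAttachingMap.coresComplement g := fun x =>
    helper_mem_coresComplement_of_norm_lt_one n g _ (norm_coneDisc_lt_one (ν i) σ hσabs x)
  -- the core of the handle in the handle chart, into `D⁴ ∖ S`
  have hB1 : ∀ x : EuclideanSpace ℝ (Fin 2), lamEmbed (ballContraction ((32 : ℝ) • x)) ∈
      Metric.closedBall (0 : EuclideanSpace ℝ (Fin 4)) 1 := fun x =>
    mem_closedBall_zero_iff.2 (norm_lamEmbed_ballContraction_lt_one x).le
  have hB2 : ∀ x : EuclideanSpace ℝ (Fin 2),
      (⟨_, hB1 x⟩ : Metric.closedBall (0 : EuclideanSpace ℝ (Fin 4)) 1) ∈ beltPiece 3 2 :=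
    fun x => (mem_beltPiece 3 2).2 (lamSq_lamEmbed_ballContraction_ne_one x)
  -- the shrunken `0`-handle chart, into `D⁴ ∖ ⋃ cores`
  have hT1 : ∀ y : EuclideanSpace ℝ (Fin 4), ballContraction ((16 : ℝ) • y) ∈
      Metric.closedBall (0 : EuclideanSpace ℝ (Fin 4)) 1 := fun y =>
    mem_closedBall_zero_iff.2 (norm_ballContraction_lt_one _).le
  have hT2 : ∀ y : EuclideanSpace ℝ (Fin 4),
      (⟨_, hT1 y⟩ : Metric.closedBall (0 : EuclideanSpace ℝ (Fin 4)) 1) ∈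
        HandleAttachingMap.coresComplement g := fun y =>
    helper_mem_coresComplement_of_norm_lt_one n g _ (norm_ballContraction_lt_one _)
  refine ⟨fun y => j (jA ⟨⟨_, hT1 y⟩, hT2 y⟩),
    fun x => if ‖x‖ < 4⁻¹ then j (jB i ⟨⟨_, hB1 x⟩, hB2 x⟩) else j (jA ⟨⟨_, hA1 x⟩, hA2 x⟩), ?_⟩
  exact isSliceDiscIn_of_coreDiscData (ν i) (g i) (hg i) hjA (hjB i).1 (hglue i) hj hσ hσeq hσbd
    (fA := fun x => ⟨⟨_, hA1 x⟩, hA2 x⟩) (fun x => rfl) (fB := fun x => ⟨⟨_, hB1 x⟩, hB2 x⟩)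
    (fun x => rfl) (τ := fun y => ⟨⟨_, hT1 y⟩, hT2 y⟩) (fun y => rfl) (fun x hx => if_pos hx)
    (fun x hx => if_neg (not_lt.2 hx)) (fun y => rfl)

end CoreSliceDisc

section FramedTubes

/-! ### Source `Summits/SmoothPoincare4/SmoothPoincare4/Theorems/VerlindeRLinksVrlComponentsHBallSliceStubFramedTubes.lean` — stub 1: disjoint framed tubes of a framed link

Original module docstring:

# Line `kirby-lemma21`, Stub 1a (`stub_exists_disjoint_framedTubes`): fully disjoint framed tubes
(crux `VerlindeRLinks.VrlComponentsHBallSlice`, item stmt-SmoothPoincare4-15874)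

This file states and proves the registered stub `stub_exists_disjoint_framedTubes` (signature verbatim
from the skeleton `Cruxes/VrlComponentsHBallSlice/Lines/kirby_lemma21.lean`): every framed link
`L ⊂ S³` with `n` components has oriented tubular neighbourhoods `νᵢ` of its components realising the
framings `L.framing i` and with pairwise disjoint (full) ranges — the first datum of the relational
surgery `IsIntegralSurgeryLink` and of the attaching maps of the trace `B⁴ ∪_L (2-handles)`.
Proof: pairwise disjoint tubes exist (`Link.exists_tubularNbhd_pairwise_disjoint`), and each can be
re-framed to any integer without changing its image (`Knot.TubularNbhd.exists_hasFraming_range_eq`,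
twisting).

References: D. Rolfsen, *Knots and Links* (1976), §9.F; R. E. Gompf, A. I. Stipsicz, *4-Manifolds and
Kirby Calculus* (1999), §4.5; R. C. Kirby, *The Topology of 4-Manifolds* (1989), Ch. I §2.
-/

open scoped _root_.Manifold _root_.ContDiff _root_.Topology
open _root_.Set _root_.Function Literature.Topology.FourManifolds

/-- **Stub 1a of line `kirby-lemma21` — fully disjoint framed tubes** (`stub_exists_disjoint_framedTubes`,
registered signature verbatim).  For every framed link `L ⊂ S³` with `n` components there are oriented
tubular neighbourhoods `νᵢ : S¹ × ℝ² ↪ S³` of the components `L.component i` with framings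
`L.framing i` (`Knot.TubularNbhd.HasFraming`) and pairwise disjoint ranges: take pairwise disjoint
tubes (`Link.exists_tubularNbhd_pairwise_disjoint`; Rolfsen §9.F) and re-frame each one by twisting,
which keeps its image (`Knot.TubularNbhd.exists_hasFraming_range_eq`; Gompf–Stipsicz §4.5).
[cite: Rolfsen1976, §9.F] [cite: GompfStipsicz1999, §4.5] -/
private theorem stub_exists_disjoint_framedTubes :
    ∀ (n : ℕ) (L : FramedLink (Fin n)),
      ∃ ν : ∀ i, Knot.TubularNbhd ⇑(L.component i),
        (∀ i, (ν i).HasFraming (L.framing i)) ∧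
        Pairwise fun i j => Disjoint (range ⇑(ν i)) (range ⇑(ν j)) := by
  intro n L
  obtain ⟨ν₀, hdisj⟩ := L.toLink.exists_tubularNbhd_pairwise_disjoint
  choose ν hrange hfr using fun i => (ν₀ i).exists_hasFraming_range_eq (L.framing i)
  refine ⟨ν, hfr, fun i j hij => ?_⟩
  show Disjoint (range ⇑(ν i)) (range ⇑(ν j))
  rw [hrange i, hrange j]
  exact hdisj hij

end FramedTubes

section BoundarySurgery

/-! ### Source `Summits/SmoothPoincare4/SmoothPoincare4/Theorems/VerlindeRLinksVrlComponentsHBallSliceStubBoundarySurgery.lean` — stub 2: the boundary of the multi-attachment is the surgery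

Original module docstring:

# Line `kirby-lemma21`, Stub 2 (`stub_isSurgery_boundary_of_isMultiAttachment`): Kirby's Lemma 2.1
# for links — the boundary of `D⁴ ∪_L (2-handles)` is the surgery on `L`
(crux `VerlindeRLinks.VrlComponentsHBallSlice`, item stmt-SmoothPoincare4-15874)

This file states and proves the registered stub `stub_isSurgery_boundary_of_isMultiAttachment`
(signature verbatim from the skeleton `Cruxes/VrlComponentsHBallSlice/Lines/kirby_lemma21.lean`): if
`P` is `D⁴` with `2`-handles attached simultaneously (Kosinski, `HandleAttachingMap.IsMultiAttachment`)
along attaching maps `gᵢ : T → D⁴` whose values on the unit disc bundle of `T ∩ ∂D⁴` are pairwise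
disjoint oriented tubular neighbourhoods `νᵢ` of the components of a framed link `L ⊂ S³ = ∂D⁴`
realising the framings `L.framing i`, then for EVERY boundary datum `bP` of `P` the boundary
`3`-manifold `bP.carrier` is the integral surgery on `L` (`L.IsSurgery (𝓡 3) bP.carrier`).  The
mathematics is the Literature theorem `FramedLink.isSurgery_boundary_of_isMultiAttachment`
(`AttachmentBoundarySurgeryLink.lean`, Kirby 1989 Ch. I Lemma 2.1 for links, landed with this stub);
here only the instantiation at `ι = Fin n`, `P : Type`.

References: R. C. Kirby, *The Topology of 4-Manifolds*, LNM 1374 (1989), Ch. I §2 Lemma 2.1, §5;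
R. E. Gompf, A. I. Stipsicz, *4-Manifolds and Kirby Calculus* (1999), §5.3; A. A. Kosinski,
*Differential Manifolds* (1993), VI §6.
-/

open scoped _root_.Manifold _root_.ContDiff _root_.Topology
open _root_.Set _root_.Function Literature.Topology.FourManifolds

/-- **Stub 2 of line `kirby-lemma21` — Kirby's Lemma 2.1 for links**
(`stub_isSurgery_boundary_of_isMultiAttachment`, registered signature verbatim): the boundary of
`D⁴` with `2`-handles attached along attaching maps whose boundary values are pairwise disjoint
framed tubes of the components of `L` is, for every boundary datum, the integral surgery on `L`
(`FramedLink.isSurgery_boundary_of_isMultiAttachment` at `ι = Fin n`, `P : Type`).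
[cite: Kirby1989, Ch. I §2 Lemma 2.1] [cite: GompfStipsicz1999, §5.3] -/
private theorem stub_isSurgery_boundary_of_isMultiAttachment :
    ∀ (n : ℕ) (L : FramedLink (Fin n))
      (g : Fin n → HandleAttachingMap 3 2 (Metric.closedBall (0 : EuclideanSpace ℝ (Fin 4)) 1))
      (ν : ∀ i, Knot.TubularNbhd ⇑(L.component i)),
      (∀ i, (ν i).HasFraming (L.framing i)) →
      (Pairwise fun i j => Disjoint (range ⇑(ν i)) (range ⇑(ν j))) →
      (∀ (i : Fin n) (y : ↥(handleTube 3 2)), tubeDepth y = 0 →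
        (g i).toFun y = (closedBallBoundaryData 3).incl (ν i (tubeAngle y, tubeFibre y))) →
      ∀ (P : Type) [TopologicalSpace P] [ChartedSpace (EuclideanHalfSpace 4) P]
        [IsManifold (𝓡∂ 4) ((⊤ : ℕ∞) : WithTop ℕ∞) P],
        HandleAttachingMap.IsMultiAttachment g (𝓡∂ 4) P →
          ∀ bP : BoundaryData (𝓡∂ 4) P (𝓡 3), L.IsSurgery (𝓡 3) bP.carrier :=
  fun _ L g ν hfr hνdisj hbd _ _ _ _ hP bP =>
    L.isSurgery_boundary_of_isMultiAttachment g ν hfr hνdisj hbd hP bP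

end BoundarySurgery

section AttachingMapOfTube

/-! ### Source `Summits/SmoothPoincare4/SmoothPoincare4/Theorems/VerlindeRLinksVrlComponentsHBallSliceStubAttachingMapOfTube.lean` — stub 3: the radial attaching map of a framed tube

Original module docstring:

# Line `kirby-lemma21`, Stub 1b (`stub_attachingMap_of_tube`): the radial attaching map of a tube
(crux `VerlindeRLinks.VrlComponentsHBallSlice`, item stmt-SmoothPoincare4-15874)

This file proves the registered stub `stub_attachingMap_of_tube` (signature verbatim from the
skeleton `Cruxes/VrlComponentsHBallSlice/Lines/kirby_lemma21.lean`): every oriented tubular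
neighbourhood `ν : S¹ × ℝ² ↪ S³` of a knot gives a Kosinski attaching map `g : T → D⁴` of a
`2`-handle on the `4`-disc (`HandleAttachingMap 3 2 (𝔻 4)`) with underlying map the RADIAL formula
`g y = (1 - depth(y)/4) · ν (angle y, fibre y)` (tube coordinates of `HandleAttachingMapOfTube.lean`).

Proof: a transcription of the tree's `TubeAttachData` construction (`HandleAttachingMapOfTube.lean`;
Kosinski, *Differential Manifolds* (1993), III §4 and VI §6) to `D⁴` with `∂D⁴ = S³` and the radial
collar `c = closedBallCollarMap 3`, `c (x, t) = (1 - t/2) • x` (a smooth embedding `S³ × [0, 1] ↪ D⁴`,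
discharged `isSmoothEmbedding_closedBallCollarMap_holds`; open below height `1`,
`image_mem_nhds_collar`), tube `ν` (an open smooth embedding with smooth inverse `ν.toHomeo.symm`,
`LinkTubularUniqueness.lean`), radius `κ = 1`, height `δ = 1/2`:
`g y = c (ν (angle y, fibre y), depth(y)/2)`.  As in the template, `g = c ∘ L` is smooth,
injective and open (the lift `L : T → S³ × [0, 1]` is a homeomorphism onto the open set `R`, with the
explicit smooth inverse `G (p, t) = depthLine θ w (2t)`, `(θ, w) = ν⁻¹ p`), its inverse is smooth by
descent along the collar (`contMDiffAt_of_comp_isImmersionAt_of_nhds`), so it is a smooth embedding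
(`isSmoothEmbedding_of_contMDiffOn_symm`), and at depth `0` it is the boundary inclusion of `ν`.
No definitions are introduced: the lift `L`, its inverse `G` and its range `R` are variables pinned
by the defining equations `h` (hypothesis of the intermediate lemmas, discharged by `rfl` at the end).

References: A. A. Kosinski, *Differential Manifolds* (1993), III §4, VI §1, VI §6; M. W. Hirsch,
*Differential Topology* (1976), §4.6; R. C. Kirby, *The Topology of 4-Manifolds* (1989), Ch. I §2.
-/

open scoped _root_.Manifold _root_.ContDiff _root_.Topology
open _root_.Set _root_.Function _root_.Metric _root_.Topology
open Literature.Topology.FourManifolds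

/-! ### The height `depth / 2` -/

/-- The height `(1 - ‖x‖²)/2` of a tube point lies in `[0, 1]`. [folklore] -/
private theorem half_tubeDepth_mem_Icc (y : handleTube 3 2) : tubeDepth y / 2 ∈ Icc (0 : ℝ) 1 := by
  have h0 := tubeDepth_nonneg y
  have h1 := tubeDepth_lt_one y
  constructor <;> linarith

/-- The height of the lift is `(1 - ‖x‖²)/2`. [folklore] -/
private theorem coe_projIcc_half_tubeDepth (y : handleTube 3 2) :
    ((projIcc (0 : ℝ) 1 zero_le_one (tubeDepth y / 2) : Icc (0 : ℝ) 1) : ℝ) = tubeDepth y / 2 := by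
  rw [projIcc_of_mem _ (half_tubeDepth_mem_Icc y)]

/-- The height of the lift is `< 1/2` (hence `< 1`). [folklore] -/
private theorem projIcc_half_tubeDepth_lt_half (y : handleTube 3 2) :
    ((projIcc (0 : ℝ) 1 zero_le_one (tubeDepth y / 2) : Icc (0 : ℝ) 1) : ℝ) < 1 / 2 := by
  rw [coe_projIcc_half_tubeDepth]
  have := tubeDepth_lt_one y
  linarith

/-- On the boundary sphere `T ∩ ∂D⁴` the height vanishes. [folklore] -/
private theorem projIcc_half_tubeDepth_eq_bot {y : handleTube 3 2} (hy : ‖tubeVec y‖ = 1) :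
    projIcc (0 : ℝ) 1 zero_le_one (tubeDepth y / 2) = ⊥ := by
  apply Subtype.ext
  rw [coe_projIcc_half_tubeDepth, (tubeDepth_eq_zero_iff y).2 hy, zero_div]
  rfl

/-! ### The radial collar of `∂D⁴` -/

/-- **The radial collar `(x, t) ↦ (1 - t/2) • x` is a smooth embedding `S³ × [0, 1] ↪ D⁴`** for the
product model with corners (the discharged named fact `isSmoothEmbedding_closedBallCollarMap` at
`n = 2`, read at `3 = 2 + 1`). [cite: Hirsch1976, §4.6] -/
private theorem isSmoothEmbedding_collar :
    Manifold.IsSmoothEmbedding ((𝓡 3).prod (𝓡∂ 1)) (𝓡∂ 4) ∞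
      (closedBallCollarMap 3 : (sphere (0 : EuclideanSpace ℝ (Fin (3 + 1))) 1) × (Icc (0 : ℝ) 1) →
        closedBall (0 : EuclideanSpace ℝ (Fin 4)) 1) :=
  isSmoothEmbedding_closedBallCollarMap_holds 2

/-- The radial collar is open below the top: it maps neighbourhoods of `q = (x, s)`, `s < 1`, to
neighbourhoods of `c q` in `D⁴` (transcription of `BoundaryData.Collar.image_mem_nhds`). [folklore] -/
private theorem image_mem_nhds_collar {q : (sphere (0 : EuclideanSpace ℝ (Fin (3 + 1))) 1) × (Icc (0 : ℝ) 1)}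
    (hq : (q.2 : ℝ) < 1) {U : Set ((sphere (0 : EuclideanSpace ℝ (Fin (3 + 1))) 1) × (Icc (0 : ℝ) 1))}
    (hU : U ∈ 𝓝 q) : closedBallCollarMap 3 '' U ∈ 𝓝 (closedBallCollarMap 3 q) := by
  obtain ⟨O, hOU, hO, hqO⟩ := _root_.mem_nhds_iff.1 (Filter.inter_mem hU
    ((isOpen_lt (continuous_subtype_val.comp continuous_snd) continuous_const).mem_nhds hq))
  -- `c '' O` is open in `D⁴`
  obtain ⟨O', hO', hOO'⟩ := isSmoothEmbedding_collar.isEmbedding.isInducing.isOpen_iff.1 hO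
  have himg : closedBallCollarMap 3 '' O = O' ∩ closedBallCollarMap 3 '' {p | (p.2 : ℝ) < 1} := by
    apply Subset.antisymm
    · rintro _ ⟨p, hp, rfl⟩
      refine ⟨?_, p, (hOU hp).2, rfl⟩
      have : p ∈ closedBallCollarMap 3 ⁻¹' O' := by rw [hOO']; exact hp
      exact this
    · rintro y ⟨hy, p, hp, rfl⟩
      exact ⟨p, by rw [← hOO']; exact hy, rfl⟩
  refine Filter.mem_of_superset ((hO'.inter (isOpen_image_closedBallCollarMap 3)).mem_nhds ?_) ?_
  · rw [← himg]; exact mem_image_of_mem _ hqO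
  · rw [← himg]; exact image_mono fun p hp => (hOU hp).1

/-- The radial collar maps open sets below height `1` to open sets (transcription of
`BoundaryData.Collar.isOpen_image_of_forall_lt_one`). [folklore] -/
private theorem isOpen_image_collar {U : Set ((sphere (0 : EuclideanSpace ℝ (Fin (3 + 1))) 1) × (Icc (0 : ℝ) 1))}
    (hU : IsOpen U) (h1 : ∀ q ∈ U, (q.2 : ℝ) < 1) : IsOpen (closedBallCollarMap 3 '' U) := by
  rw [isOpen_iff_mem_nhds]
  rintro _ ⟨q, hq, rfl⟩
  exact image_mem_nhds_collar (h1 q hq) (hU.mem_nhds hq)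

/-! ### The lift `L`, its inverse `G` and its range `R` -/

variable {K : sphere (0 : EuclideanSpace ℝ (Fin (1 + 1))) 1 → sphere (0 : EuclideanSpace ℝ (Fin (3 + 1))) 1}
  (ν : Knot.TubularNbhd K)
  {L : handleTube 3 2 → (sphere (0 : EuclideanSpace ℝ (Fin (3 + 1))) 1) × (Icc (0 : ℝ) 1)}
  {G : (sphere (0 : EuclideanSpace ℝ (Fin (3 + 1))) 1) × (Icc (0 : ℝ) 1) → handleTube 3 2}
  {R : Set ((sphere (0 : EuclideanSpace ℝ (Fin (3 + 1))) 1) × (Icc (0 : ℝ) 1))}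
  /- The defining equations of the three pieces of the construction: the lift
  `L y = (ν (x_λ/|x_λ|, x_μ), (1 - ‖x‖²)/2)`, its inverse `G (p, t) = depthLine θ w (2t)`
  (`(θ, w) = ν⁻¹ p`: the point of `T` with angle `θ`, fibre `w` and depth `2t`), and its range `R`
  (cylinder points over `range ν`, of height `< 1/2`, with positive recovered `λ`-radius). -/
  (h : (L = fun y => (ν (tubeAngle y, tubeFibre y), projIcc (0 : ℝ) 1 zero_le_one (tubeDepth y / 2))) ∧
    (G = fun q => depthLine (ν.toHomeo.symm q.1).1 (ν.toHomeo.symm q.1).2 (2 * (q.2 : ℝ))) ∧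
    R = {q | q.1 ∈ range ν ∧ (q.2 : ℝ) < 1 / 2 ∧
      0 < 1 - 2 * (q.2 : ℝ) - ‖(ν.toHomeo.symm q.1).2‖ ^ 2})

include h

/-- **The lift `T → S³ × [0, 1]` is smooth** (`T` as an open submanifold of `D⁴`, the cylinder
with the product model with corners). [folklore] -/
private theorem contMDiff_lift : ContMDiff (𝓡∂ 4) ((𝓡 3).prod (𝓡∂ 1)) ∞ L := by
  obtain ⟨rfl, -, -⟩ := h
  have h1 : ContMDiff (𝓡∂ 4) (𝓡 3) ∞ fun y : handleTube 3 2 => ν (tubeAngle y, tubeFibre y) :=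
    ν.contMDiff.comp (contMDiff_tubeAngle.prodMk contMDiff_tubeFibre)
  have h2 : ContMDiff (𝓡∂ 4) 𝓘(ℝ, ℝ) ∞ fun y : handleTube 3 2 => tubeDepth y / 2 :=
    (contDiff_id.div_const (2 : ℝ)).contMDiff.comp contMDiff_tubeDepth
  exact h1.prodMk (contMDiffOn_projIcc.comp_contMDiff h2 fun y => half_tubeDepth_mem_Icc y)

/-- The attaching map `c ∘ L` is smooth. [folklore] -/
private theorem contMDiff_amap : ContMDiff (𝓡∂ 4) (𝓡∂ 4) ∞ (closedBallCollarMap 3 ∘ L) :=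
  isSmoothEmbedding_collar.contMDiff.comp (contMDiff_lift ν h)

/-- The lift lands in `R`: the recovered `λ`-radius of `L y` is `|x_λ|² > 0`. [folklore] -/
private theorem lift_mem (y : handleTube 3 2) : L y ∈ R := by
  obtain ⟨rfl, -, rfl⟩ := h
  refine ⟨mem_range_self _, projIcc_half_tubeDepth_lt_half y, ?_⟩
  show 0 < 1 - 2 * ((projIcc (0 : ℝ) 1 zero_le_one (tubeDepth y / 2) : Icc (0 : ℝ) 1) : ℝ) -
    ‖(ν.toHomeo.symm (ν (tubeAngle y, tubeFibre y))).2‖ ^ 2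
  rw [ν.toHomeo_symm_apply, coe_projIcc_half_tubeDepth,
    show (1 : ℝ) - 2 * (tubeDepth y / 2) = 1 - tubeDepth y by ring, ← norm_lamPart_sq_eq]
  exact pow_pos (norm_lamPart_tubeVec_pos y) 2

/-- `G ∘ L = id` (`depthLine_tube`). [folklore] -/
private theorem G_L (y : handleTube 3 2) : G (L y) = y := by
  obtain ⟨rfl, rfl, -⟩ := h
  show depthLine (ν.toHomeo.symm (ν (tubeAngle y, tubeFibre y))).1
    (ν.toHomeo.symm (ν (tubeAngle y, tubeFibre y))).2
    (2 * ((projIcc (0 : ℝ) 1 zero_le_one (tubeDepth y / 2) : Icc (0 : ℝ) 1) : ℝ)) = y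
  rw [ν.toHomeo_symm_apply, coe_projIcc_half_tubeDepth,
    show 2 * (tubeDepth y / 2) = tubeDepth y by ring]
  exact depthLine_tube y

/-- `L ∘ G = id` on `R`. [folklore] -/
private theorem L_G {q : (sphere (0 : EuclideanSpace ℝ (Fin (3 + 1))) 1) × (Icc (0 : ℝ) 1)} (hq : q ∈ R) :
    L (G q) = q := by
  obtain ⟨rfl, rfl, rfl⟩ := h
  obtain ⟨hp, -, hpos⟩ := hq
  have ht0 : (0 : ℝ) ≤ 2 * (q.2 : ℝ) := mul_nonneg zero_le_two q.2.2.1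
  beta_reduce
  rw [tubeAngle_depthLine _ _ ht0 hpos, tubeFibre_depthLine _ _ ht0 hpos,
    tubeDepth_depthLine _ _ ht0 hpos, Prod.mk.eta, ν.apply_toHomeo_symm hp]
  refine Prod.ext rfl (Subtype.ext ?_)
  show ((projIcc (0 : ℝ) 1 zero_le_one (2 * (q.2 : ℝ) / 2) : Icc (0 : ℝ) 1) : ℝ) = q.2
  rw [show 2 * (q.2 : ℝ) / 2 = q.2 by ring, projIcc_val]

/-- The underlying vector of `G q` is `mkVec θ w (2t)`, for `q ∈ R`. [folklore] -/
private theorem tubeVec_G {q : (sphere (0 : EuclideanSpace ℝ (Fin (3 + 1))) 1) × (Icc (0 : ℝ) 1)}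
    (hq : q ∈ R) :
    tubeVec (G q) =
      mkVec ((ν.toHomeo.symm q.1).1 : EuclideanSpace ℝ (Fin 2)) (ν.toHomeo.symm q.1).2
        (2 * (q.2 : ℝ)) := by
  obtain ⟨-, rfl, rfl⟩ := h
  exact tubeVec_depthLine _ _ (mul_nonneg zero_le_two q.2.2.1) hq.2.2

/-- **The lift is injective** (it has the left inverse `G`). [folklore] -/
private theorem injective_lift : Injective L := fun y y' hyy => by
  have h' := congrArg G hyy
  rwa [G_L ν h, G_L ν h] at h'

/-- **The range of the lift is `R`.** [folklore] -/
private theorem range_lift : range L = R :=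
  Subset.antisymm (range_subset_iff.2 (lift_mem ν h)) fun _ hq => ⟨_, L_G ν h hq⟩

/-! ### `R` is open and `G` is smooth on it -/

/-- **`R` is open.** [folklore] -/
private theorem isOpen_R : IsOpen R := by
  obtain ⟨-, -, rfl⟩ := h
  have hS : IsOpen {q : (sphere (0 : EuclideanSpace ℝ (Fin (3 + 1))) 1) × (Icc (0 : ℝ) 1) |
      q.1 ∈ range ν} :=
    ν.isOpenEmbedding.isOpen_range.preimage continuous_fst
  have h1 : Continuous fun q : (sphere (0 : EuclideanSpace ℝ (Fin (3 + 1))) 1) × (Icc (0 : ℝ) 1) =>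
      (q.2 : ℝ) := continuous_subtype_val.comp continuous_snd
  have h2 : ContinuousOn (fun q : (sphere (0 : EuclideanSpace ℝ (Fin (3 + 1))) 1) × (Icc (0 : ℝ) 1) =>
      ‖(ν.toHomeo.symm q.1).2‖ ^ 2) {q | q.1 ∈ range ν} :=
    ((continuous_norm.comp continuous_snd).pow 2).comp_continuousOn
      (ν.toHomeo.continuousOn_symm.comp continuous_fst.continuousOn fun _ hq => by
        rw [ν.toHomeo_target]; exact hq)
  have hg : ContinuousOn (fun q : (sphere (0 : EuclideanSpace ℝ (Fin (3 + 1))) 1) × (Icc (0 : ℝ) 1) =>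
      ((q.2 : ℝ), 1 - 2 * (q.2 : ℝ) - ‖(ν.toHomeo.symm q.1).2‖ ^ 2)) {q | q.1 ∈ range ν} :=
    h1.continuousOn.prodMk ((continuousOn_const.sub (continuous_const.mul h1).continuousOn).sub h2)
  have h := hg.isOpen_inter_preimage hS
    ((isOpen_Iio (a := (1 / 2 : ℝ))).prod (isOpen_Ioi (a := (0 : ℝ))))
  convert h using 1
  ext q
  simp only [mem_setOf_eq, mem_inter_iff, mem_preimage, mem_prod, mem_Iio, mem_Ioi]

/-- **`G` is smooth on `R`** (into the open submanifold `T` of `D⁴`: test in `ℝ⁴`, where it is the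
smooth vector `mkVec θ w (2t)`, `contMDiffOn_mkVec`). [folklore] -/
private theorem contMDiffOn_G : ContMDiffOn ((𝓡 3).prod (𝓡∂ 1)) (𝓡∂ 4) ∞ G R := by
  -- the recovered vector is smooth on `R`
  have hR : ∀ q ∈ R, q.1 ∈ range ν ∧ 0 < 1 - 2 * (q.2 : ℝ) - ‖(ν.toHomeo.symm q.1).2‖ ^ 2 := by
    obtain ⟨-, -, rfl⟩ := h
    exact fun q hq => ⟨hq.1, hq.2.2⟩
  have hsymm : ContMDiffOn ((𝓡 3).prod (𝓡∂ 1)) ((𝓡 1).prod 𝓘(ℝ, EuclideanSpace ℝ (Fin 2))) ∞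
      (fun q : (sphere (0 : EuclideanSpace ℝ (Fin (3 + 1))) 1) × (Icc (0 : ℝ) 1) =>
        ν.toHomeo.symm q.1) R :=
    ν.contMDiffOn_toHomeo_symm.comp contMDiffOn_fst fun q hq => (hR q hq).1
  have hV : ContMDiffOn ((𝓡 3).prod (𝓡∂ 1)) 𝓘(ℝ, EuclideanSpace ℝ (Fin 4)) ∞
      (fun q : (sphere (0 : EuclideanSpace ℝ (Fin (3 + 1))) 1) × (Icc (0 : ℝ) 1) =>
        mkVec ((ν.toHomeo.symm q.1).1 : EuclideanSpace ℝ (Fin 2)) (ν.toHomeo.symm q.1).2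
          (2 * (q.2 : ℝ))) R :=
    contMDiffOn_mkVec
      (((@contMDiff_coe_sphere _ _ _ _ 1 (fact_finrank_euclideanSpace_succ 1)).comp
        contMDiff_fst).comp_contMDiffOn hsymm)
      (contMDiff_snd.comp_contMDiffOn hsymm)
      ((contDiff_const.mul contDiff_id).contMDiff.comp
        (contMDiff_subtype_coe_Icc.comp contMDiff_snd)).contMDiffOn
      fun q hq => (hR q hq).2
  -- hence `G`, tested in `ℝ⁴`
  intro q₀ hq₀
  apply ContMDiffAt.contMDiffWithinAt
  have hopen : R ∈ 𝓝 q₀ := (isOpen_R ν h).mem_nhds hq₀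
  have hfs : ContMDiffAt ((𝓡 3).prod (𝓡∂ 1)) 𝓘(ℝ, EuclideanSpace ℝ (Fin 4)) ∞
      (fun q => tubeVec (G q)) q₀ :=
    ((hV q₀ hq₀).contMDiffAt hopen).congr_of_eventuallyEq (by
      filter_upwards [hopen] with q hq
      exact tubeVec_G ν h hq)
  have hmem : ∀ q, tubeVec (G q) ∈ closedBall (0 : EuclideanSpace ℝ (Fin 4)) 1 := fun q =>
    ((G q : handleTube 3 2) : closedBall (0 : EuclideanSpace ℝ (Fin 4)) 1).2
  have h1 := hfs.codRestrict_closedBall hmem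
  have h2 : codRestrict (fun q => tubeVec (G q)) (closedBall (0 : EuclideanSpace ℝ (Fin 4)) 1) hmem =
      Subtype.val ∘ G := by
    funext q; exact Subtype.ext rfl
  rw [h2] at h1
  exact (ContMDiffAt.subtypeVal_comp_iff (handleTube 3 2) G q₀).1 h1

/-! ### The attaching map is an open embedding with smooth inverse -/

/-- The lift maps open sets to open sets (a homeomorphism onto the open set `R`). [folklore] -/
private theorem isOpen_image_lift {U : Set (handleTube 3 2)} (hU : IsOpen U) : IsOpen (L '' U) := by
  have hU' : L '' U = R ∩ G ⁻¹' U := by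
    ext q
    constructor
    · rintro ⟨y, hy, rfl⟩
      refine ⟨lift_mem ν h y, ?_⟩
      rw [mem_preimage, G_L ν h]
      exact hy
    · rintro ⟨hq, hqU⟩
      exact ⟨_, hqU, L_G ν h hq⟩
  rw [hU']
  exact (contMDiffOn_G ν h).continuousOn.isOpen_inter_preimage (isOpen_R ν h) hU

/-- **The attaching map is open** (the collar is open below height `1`). [folklore] -/
private theorem isOpenMap_amap : IsOpenMap (closedBallCollarMap 3 ∘ L) := by
  intro U hU
  rw [image_comp]
  refine isOpen_image_collar (isOpen_image_lift ν h hU) ?_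
  rintro _ ⟨y, -, rfl⟩
  obtain ⟨rfl, -, -⟩ := h
  exact (projIcc_half_tubeDepth_lt_half y).trans one_half_lt_one

/-- The attaching map is an open topological embedding. [folklore] -/
private theorem isOpenEmbedding_amap : IsOpenEmbedding (closedBallCollarMap 3 ∘ L) :=
  .of_continuous_injective_isOpenMap (contMDiff_amap ν h).continuous
    ((injective_closedBallCollarMap 3).comp (injective_lift ν h)) (isOpenMap_amap ν h)

/-- **The inverse of the attaching map is smooth on its range**, by descent along the collar:
near each point of `R`, `g⁻¹ ∘ c` is the smooth map `G`, and the collar is an immersion open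
at points of height `< 1` (Kosinski (1993), VI §1, proof of (1.1)). [cite: Kosinski1993, VI §1] -/
private theorem contMDiffOn_symm_amap :
    ContMDiffOn (𝓡∂ 4) (𝓡∂ 4) ∞
      ((isOpenEmbedding_amap ν h).toOpenPartialHomeomorph (closedBallCollarMap 3 ∘ L)).symm
      (range (closedBallCollarMap 3 ∘ L)) := by
  rintro _ ⟨y, rfl⟩
  apply ContMDiffAt.contMDiffWithinAt
  set F := ((isOpenEmbedding_amap ν h).toOpenPartialHomeomorph (closedBallCollarMap 3 ∘ L)).symm
  have hopen : R ∈ 𝓝 (L y) := (isOpen_R ν h).mem_nhds (lift_mem ν h y)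
  have key : ContMDiffAt ((𝓡 3).prod (𝓡∂ 1)) (𝓡∂ 4) ∞ (fun q => F (closedBallCollarMap 3 q))
      (L y) := by
    refine (((contMDiffOn_G ν h) _ (lift_mem ν h y)).contMDiffAt hopen).congr_of_eventuallyEq ?_
    filter_upwards [hopen] with q hq
    obtain ⟨w, rfl⟩ : q ∈ range L := by rw [range_lift ν h]; exact hq
    rw [G_L ν h]
    exact (isOpenEmbedding_amap ν h).toOpenPartialHomeomorph_left_inv (f := closedBallCollarMap 3 ∘ L)
  have hlt : ((L y).2 : ℝ) < 1 := by
    obtain ⟨rfl, -, -⟩ := h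
    exact (projIcc_half_tubeDepth_lt_half y).trans one_half_lt_one
  change ContMDiffAt (𝓡∂ 4) (𝓡∂ 4) ∞ F (closedBallCollarMap 3 (L y))
  exact contMDiffAt_of_comp_isImmersionAt_of_nhds
    (isSmoothEmbedding_collar.isImmersion.isImmersionAt (L y))
    (fun U hU => image_mem_nhds_collar hlt hU) key fun _ => rfl

/-- **The attaching map is a smooth embedding `T → D⁴`** (`Manifold.IsSmoothEmbedding` for `𝓡∂ 4`
on both sides). [cite: Kosinski1993, III §4 and VI §6] -/
private theorem isSmoothEmbedding_amap :
    Manifold.IsSmoothEmbedding (𝓡∂ 4) (𝓡∂ 4) ∞ (closedBallCollarMap 3 ∘ L) :=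
  isSmoothEmbedding_of_contMDiffOn_symm (isOpenEmbedding_amap ν h) (contMDiff_amap ν h)
    (contMDiffOn_symm_amap ν h)

/-- Points of the boundary sphere `T ∩ ∂D⁴` go to `∂D⁴`: there the height vanishes and the collar
is the boundary inclusion `closedBallCollarMap_apply_bot`. [cite: Kosinski1993, VI §6] -/
private theorem amap_of_norm_eq_one {y : handleTube 3 2} (hy : ‖tubeVec y‖ = 1) :
    (closedBallCollarMap 3 ∘ L) y = (closedBallBoundaryData 3).incl (ν (tubeAngle y, tubeFibre y)) := by
  obtain ⟨rfl, -, -⟩ := h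
  rw [comp_apply, projIcc_half_tubeDepth_eq_bot hy]
  exact closedBallCollarMap_apply_bot 3 _

/-- **The radial formula**: as a vector of `ℝ⁴`,
`c (ν (angle y, fibre y), depth(y)/2) = (1 - depth(y)/4) • ν (angle y, fibre y)`. [folklore] -/
private theorem coe_amap (y : handleTube 3 2) :
    (((closedBallCollarMap 3 ∘ L) y : closedBall (0 : EuclideanSpace ℝ (Fin 4)) 1) :
        EuclideanSpace ℝ (Fin 4)) =
      (1 - tubeDepth y / 4) •
        ((ν (tubeAngle y, tubeFibre y) : sphere (0 : EuclideanSpace ℝ (Fin (3 + 1))) 1) :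
          EuclideanSpace ℝ (Fin 4)) := by
  obtain ⟨rfl, -, -⟩ := h
  rw [comp_apply, coe_closedBallCollarMap, coe_projIcc_half_tubeDepth]
  congr 1
  ring

omit h

/-! ### The stub -/

/-- **Stub 1b of line `kirby-lemma21` — the radial attaching map of a tube**
(`stub_attachingMap_of_tube`, registered signature verbatim).  For every oriented tubular
neighbourhood `ν : S¹ × ℝ² ↪ S³` of a knot `K` there is a Kosinski attaching map `g : T → D⁴` of a
`2`-handle on the `4`-disc (`HandleAttachingMap 3 2 (𝔻 4)`: a smooth embedding of the tube
`T = {x ∈ D⁴ | x_λ ≠ 0}` with open range taking `T ∩ ∂D⁴` into `∂D⁴`) given by the RADIAL formula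
`g y = (1 - depth(y)/4) · ν (angle y, fibre y)` in the tube coordinates of
`HandleAttachingMapOfTube.lean` (`tubeAngle y = x_λ/|x_λ|`, `tubeFibre y = x_μ`,
`tubeDepth y = 1 - ‖x‖²`): Kosinski's `h̄ = c ∘ L` for the tube `ν` in `∂D⁴ = S³` prolonged
along the radial collar `c (x, t) = (1 - t/2) • x` at height `depth/2`.
[cite: Kosinski1993, III §4 and VI §6] -/
private theorem stub_attachingMap_of_tube :
    ∀ (K : Knot) (ν : Knot.TubularNbhd ⇑K),
      ∃ g : HandleAttachingMap 3 2 (Metric.closedBall (0 : EuclideanSpace ℝ (Fin 4)) 1),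
        ∀ y : ↥(handleTube 3 2),
          ((g.toFun y : Metric.closedBall (0 : EuclideanSpace ℝ (Fin 4)) 1) : EuclideanSpace ℝ (Fin 4)) =
            (1 - tubeDepth y / 4) •
              ((ν (tubeAngle y, tubeFibre y) : Metric.sphere (0 : EuclideanSpace ℝ (Fin 4)) 1) :
                EuclideanSpace ℝ (Fin 4)) := by
  intro K ν
  have h := And.intro (Eq.refl fun y : handleTube 3 2 =>
      (ν (tubeAngle y, tubeFibre y), projIcc (0 : ℝ) 1 zero_le_one (tubeDepth y / 2)))
    (And.intro (Eq.refl fun q : (sphere (0 : EuclideanSpace ℝ (Fin (3 + 1))) 1) × (Icc (0 : ℝ) 1) =>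
      depthLine (ν.toHomeo.symm q.1).1 (ν.toHomeo.symm q.1).2 (2 * (q.2 : ℝ)))
      (Eq.refl {q : (sphere (0 : EuclideanSpace ℝ (Fin (3 + 1))) 1) × (Icc (0 : ℝ) 1) |
        q.1 ∈ range ν ∧ (q.2 : ℝ) < 1 / 2 ∧ 0 < 1 - 2 * (q.2 : ℝ) - ‖(ν.toHomeo.symm q.1).2‖ ^ 2}))
  refine ⟨⟨_, isSmoothEmbedding_amap ν h, (isOpenMap_amap ν h).isOpen_range, fun y hy => ?_⟩,
    fun y => coe_amap ν h y⟩
  show (𝓡∂ 4).IsBoundaryPoint ((closedBallCollarMap 3 ∘ _) y)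
  rw [amap_of_norm_eq_one ν h hy]
  exact (closedBallBoundaryData 3).incl_mem_boundary _

end AttachingMapOfTube

section Reduction

/-! ### Source `Summits/SmoothPoincare4/SmoothPoincare4/Theorems/VerlindeRLinksVrlComponentsHBallSliceReduction.lean` — the sorry-free composition of line kirby-lemma21

Original module docstring:

# Line `kirby-lemma21` — the crux `VerlindeRLinks.VrlComponentsHBallSlice` (stmt-SmoothPoincare4-15874)
# REDUCED to Kirby's sentence `∂(♮ⁿ S¹ × B³) = #ⁿ(S² × S¹)` / to the `S⁰`-surgery lemma

Crux (route `route-SmoothPoincare4-VerlindeRLinks`, item #9, Gompf–Scharlemann–Thompson 2010 Prop. 2.3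
(Hillman), componentwise): every component `L.component i` of an R-link `L ⊂ S³` (`n` components, the
integral surgery `Y` on `L` is `#ⁿ(S² × S¹)` in the sense `IsSphereTwoProdCircleSum n Y`) is slice in a
homotopy `4`-ball (`Knot.IsHomotopyBallSlice`).

This file is the SORRY-FREE COMPOSITION of the registered skeleton `Cruxes/VrlComponentsHBallSlice/Lines/
kirby_lemma21.lean` (lead's reshape, 5 stubs) run on the four LANDED stubs

* `stub_exists_disjoint_framedTubes` (`…StubFramedTubes.lean`),
* `stub_attachingMap_of_tube` (`…StubAttachingMapOfTube.lean`),
* `stub_isSurgery_boundary_of_isMultiAttachment` (`…StubBoundarySurgery.lean`, Kirby's Lemma 2.1 for links),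
* `stub_core_isSliceDiscIn_of_isMultiAttachment` (`…StubCoreSliceDisc.lean`),

with the fifth, `stub_oneHandlebody_boundary` — VERBATIM the Literature named fact
`exists_oneHandlebody_four_boundary_isSphereTwoProdCircleSum` (`OneHandlebodyBoundarySum.lean`, Kirby 1989,
Ch. I §2, p. 8: some compact connected orientable `(1,n)`-handlebody has a boundary datum `#ⁿ(S² × S¹)`) —
kept as a HYPOTHESIS.  Three registered helper stubs record the reduction at three depths:

* `helper_crux_of_kirbySentence` — the crux from Kirby's sentence;
* `helper_crux_of_step` — the crux from the one-handle step
  `isConnectedSum_boundary_of_isHandleAttachment_one` (`∂(V' ∪ h¹) = ∂V' # (S² × S¹)`; Kirby's sentence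
  is PROVED from it in `OneHandlebodyBoundarySum.lean`, `…_of_step`);
* `helper_crux_of_zeroSphereSurgery` — the crux from piece (2) of the roadmap alone: *`0`-surgery along a
  framed `S⁰` in a connected `3`-manifold with orientable result is `· # (S² × S¹)`* (the step is PROVED
  from it in `OneHandlebodyBoundarySumProofs.lean`, using the LANDED piece (1)
  `IsHandleAttachment.exists_framedSphereFamily_isSurgery_boundary`).

THE LINE (unchanged).  Close the trace `P = D⁴ ∪_L (2-handles)` — Kosinski's simultaneous attachment
(`HandleAttachingMap.IsMultiAttachment`, existence discharged) along the RADIAL attaching maps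
`gᵢ y = (1 - depth(y)/4) · νᵢ (angle y, fibre y)` of disjoint framed tubes — with a `(1,n)`-handlebody `V`
(`∂P` is the surgery on `L` by stub 2, `≅ Y ≅ #ⁿ(S² × S¹) ≅ ∂V` by uniqueness of link surgery and of
`#ⁿ(S² × S¹)`) to the R-link sphere `X = P ∪_φ V`, a homotopy `4`-sphere
(`IsRLinkSphere.nonempty_homotopyEquiv_sphere_holds`, PROVED), and read the core of the `i`-th handle in
`X` (stub 4): an `IsSliceDiscIn` datum, whence `Knot.IsSliceDiscIn.isHomotopyBallSlice`.

## References

* R. C. Kirby, *The Topology of 4-Manifolds*, LNM 1374 (1989), Ch. I §2 (p. 8), Lemma 2.1, §5. [Kirby1989]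
* R. E. Gompf, M. Scharlemann, A. Thompson, Geom. Topol. 14 (2010) 2305–2347 (arXiv:1103.1601),
  Prop. 2.3 and §9. [GompfScharlemannThompson2010]
* A. A. Kosinski, *Differential Manifolds* (1993), III §4, VI §6, §9. [Kosinski1993]
* R. E. Gompf, A. I. Stipsicz, *4-Manifolds and Kirby Calculus* (1999), §5.3, Prop. 5.1.2. [GompfStipsicz1999]
-/

open scoped _root_.Manifold _root_.ContDiff _root_.Topology
open _root_.Set _root_.Function
open Literature.Topology.FourManifolds

/-! The five stubs are the landed theorems `stub_exists_disjoint_framedTubes`, `stub_attachingMap_of_tube`,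
`stub_isSurgery_boundary_of_isMultiAttachment`, `stub_oneHandlebody_boundary`,
`stub_core_isSliceDiscIn_of_isMultiAttachment` of this namespace (files `…Stub*.lean`, imported above). -/

/-! ## Sorry-free composition, 0: bookkeeping of the radial attaching maps -/

section Radial

variable {n : ℕ} {L : FramedLink (Fin n)}
  {g : Fin n → HandleAttachingMap 3 2 (Metric.closedBall (0 : EuclideanSpace ℝ (Fin 4)) 1)}
  {ν : ∀ i, Knot.TubularNbhd ⇑(L.component i)}

/-- **Boundary values of the radial attaching maps**: at depth `0` (i.e. on `T ∩ ∂D⁴`) the radial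
formula `gᵢ y = (1 - depth(y)/4) · νᵢ (angle y, fibre y)` reads `gᵢ y = incl (νᵢ (angle y, fibre y))`
— the clause `carvedEmbed_handle` of `DottedCircleDiagram.Realization` with carved ball `𝔻 4`.
[Kosinski1993, VI §6]
[folklore] -/
private theorem boundaryValues_of_radial
    (hg : ∀ (i : Fin n) (y : ↥(handleTube 3 2)),
      (((g i).toFun y : Metric.closedBall (0 : EuclideanSpace ℝ (Fin 4)) 1) : EuclideanSpace ℝ (Fin 4)) =
        (1 - tubeDepth y / 4) •
          ((ν i (tubeAngle y, tubeFibre y) : Metric.sphere (0 : EuclideanSpace ℝ (Fin 4)) 1) :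
            EuclideanSpace ℝ (Fin 4))) :
    ∀ (i : Fin n) (y : ↥(handleTube 3 2)), tubeDepth y = 0 →
      (g i).toFun y = (closedBallBoundaryData 3).incl (ν i (tubeAngle y, tubeFibre y)) := by
  intro i y hy
  apply Subtype.ext
  rw [hg i y, hy, coe_incl_three]
  simp

/-- **The radial attaching maps of disjoint tubes have disjoint ranges**: `gᵢ y = gⱼ y'` forces equal
`D⁴`-radii `1 - depth/4 ∈ (3/4, 1]`, hence equal directions `νᵢ (…) = νⱼ (…)`, impossible for `i ≠ j`
when the tubes have disjoint ranges. [Kosinski1993, VI §6]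
[folklore] -/
private theorem pairwise_disjoint_range_of_radial
    (hν : Pairwise fun i j => Disjoint (range ⇑(ν i)) (range ⇑(ν j)))
    (hg : ∀ (i : Fin n) (y : ↥(handleTube 3 2)),
      (((g i).toFun y : Metric.closedBall (0 : EuclideanSpace ℝ (Fin 4)) 1) : EuclideanSpace ℝ (Fin 4)) =
        (1 - tubeDepth y / 4) •
          ((ν i (tubeAngle y, tubeFibre y) : Metric.sphere (0 : EuclideanSpace ℝ (Fin 4)) 1) :
            EuclideanSpace ℝ (Fin 4))) :
    Pairwise fun i j => Disjoint (range (g i).toFun) (range (g j).toFun) := by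
  intro i j hij
  refine Set.disjoint_left.2 ?_
  rintro _ ⟨y, rfl⟩ ⟨y', hy'⟩
  -- equal points of `D⁴` have equal radii and equal directions
  have hv : (1 - tubeDepth y' / 4) •
      ((ν j (tubeAngle y', tubeFibre y') : Metric.sphere (0 : EuclideanSpace ℝ (Fin 4)) 1) :
        EuclideanSpace ℝ (Fin 4)) =
      (1 - tubeDepth y / 4) •
      ((ν i (tubeAngle y, tubeFibre y) : Metric.sphere (0 : EuclideanSpace ℝ (Fin 4)) 1) :
        EuclideanSpace ℝ (Fin 4)) := by
    rw [← hg j y', ← hg i y, hy']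
  have hc : 0 < 1 - tubeDepth y / 4 := by
    have := tubeDepth_lt_one y; linarith
  have hc' : 0 < 1 - tubeDepth y' / 4 := by
    have := tubeDepth_lt_one y'; linarith
  have hn : 1 - tubeDepth y' / 4 = 1 - tubeDepth y / 4 := by
    have := congrArg norm hv
    rwa [norm_smul, norm_smul, Real.norm_of_nonneg hc.le, Real.norm_of_nonneg hc'.le,
      norm_eq_of_mem_sphere, norm_eq_of_mem_sphere, mul_one, mul_one] at this
  rw [hn] at hv
  have hdir : (ν j (tubeAngle y', tubeFibre y') : Metric.sphere (0 : EuclideanSpace ℝ (Fin 4)) 1) =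
      ν i (tubeAngle y, tubeFibre y) :=
    Subtype.ext (smul_right_injective _ hc.ne' hv)
  have hmem : (ν i (tubeAngle y, tubeFibre y) : Metric.sphere (0 : EuclideanSpace ℝ (Fin 4)) 1) ∈
      range ⇑(ν j) := ⟨_, hdir⟩
  exact Set.disjoint_left.1 (hν hij) (mem_range_self _) hmem

/-- **`D⁴` with `2`-handles attached along the radial attaching maps of framed tubes of the components
of `L` is a trace of `L`**: the realization record of `DottedCircleDiagram.ofFramedLink L` with carved
ball `𝔻 4` itself (`carvedEmbed = Subtype.val`, no dual handles), exactly as in the `n = 1` theorem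
`HandleAttachingMap.exists_isTrace_of_isMultiAttachment`. [Kirby1989, Ch. I §2 (p. 8)]
[Kosinski1993, VI §6]
[folklore] -/
private theorem isTrace_of_isMultiAttachment (hfr : ∀ i, (ν i).HasFraming (L.framing i))
    (hbd : ∀ (i : Fin n) (y : ↥(handleTube 3 2)), tubeDepth y = 0 →
      (g i).toFun y = (closedBallBoundaryData 3).incl (ν i (tubeAngle y, tubeFibre y)))
    {P : Type} [TopologicalSpace P] [ChartedSpace (EuclideanHalfSpace 4) P]
    (hP : HandleAttachingMap.IsMultiAttachment g (𝓡∂ 4) P) : L.IsTrace P := by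
  obtain ⟨hdisj, jA, jB, hjA, hjAo, hjB, hcov, hglue, hdisjB⟩ := hP
  exact ⟨{
    carved := Metric.closedBall (0 : EuclideanSpace ℝ (Fin 4)) 1
    dual := fun i => i.elim0
    disjoint_dual := fun i => i.elim0
    carvedEmbed := Subtype.val
    discHandle := fun i => i.elim0
    isSmoothEmbedding_carvedEmbed := Manifold.IsSmoothEmbedding.of_opens _
    isOpen_range_carvedEmbed := by
      rw [Subtype.range_coe_subtype]
      exact (HandleAttachingMap.coresComplement _).isOpen
    isSmoothEmbedding_discHandle := fun i => i.elim0
    isOpen_range_discHandle := fun i => i.elim0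
    cover_closedBall := eq_univ_of_forall fun x => Or.inl ⟨⟨x, by simp⟩, rfl⟩
    carvedEmbed_eq_discHandle_iff := fun i => i.elim0
    disjoint_discHandle := fun i => i.elim0
    discHandle_beltDiscPt := fun i => i.elim0
    handle := g
    disjoint_handle := hdisj
    handle_mem := fun j y => (HandleAttachingMap.mem_coresComplement _).2 fun i => i.elim0
    tube := ν
    hasFraming_tube := hfr
    carvedEmbed_handle := fun j y hy => hbd j y hy
    glued := jA
    handlePiece := jB
    isSmoothEmbedding_glued := hjA
    isOpen_range_glued := hjAo
    isSmoothEmbedding_handlePiece := fun j => (hjB j).1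
    isOpen_range_handlePiece := fun j => (hjB j).2
    cover := hcov
    glued_eq_handlePiece_iff := hglue
    disjoint_handlePiece := hdisjB }⟩

end Radial

/-! ## Sorry-free composition, I: the five stubs give the crux -/

/-- **Composition with the five stub signatures as explicit hypotheses** (GST 2010, proof of Prop. 2.3
closed up as in §9): framed tubes with disjoint ranges (stub 1a) and their radial attaching maps
(stub 1b, one per component; boundary values and disjoint ranges by `boundaryValues_of_radial`,
`pairwise_disjoint_range_of_radial`); attach the handles (`HandleAttachingMap.exists_isMultiAttachment_holds`,
discharged): a compact trace `P` (`isTrace_of_isMultiAttachment`) whose canonical boundary `∂P`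
(`BoundaryManifold.boundaryData`) is a surgery on `L` (stub 2), hence `≅ Y` (uniqueness of link surgery,
`FramedLink.IsSurgery.nonempty_diffeomorph_holds`), hence `#ⁿ(S² × S¹)`; a `(1,n)`-handlebody `V` with
`∂V ≅ #ⁿ(S² × S¹) ≅ ∂P` (stub 3, `IsSphereTwoProdCircleSum.nonempty_diffeomorph`); glue `X = P ∪_φ V`
(`exists_isBoundaryGluing_holds`): an R-link sphere (`IsRLinkSphere.mk`), compact and `≃ₕ S⁴`
(`IsRLinkSphere.nonempty_homotopyEquiv_sphere_holds`, PROVED); the core of the `i`-th handle read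
through the gluing embedding `jP : P ↪ X` (stub 4) is an `IsSliceDiscIn` datum, whence
`Knot.IsSliceDiscIn.isHomotopyBallSlice`. [GompfScharlemannThompson2010, Prop. 2.3 and §9]
[folklore] -/
private theorem isHomotopyBallSlice_of_stubs
    (hT : ∀ (n : ℕ) (L : FramedLink (Fin n)),
      ∃ ν : ∀ i, Knot.TubularNbhd ⇑(L.component i),
        (∀ i, (ν i).HasFraming (L.framing i)) ∧
        Pairwise fun i j => Disjoint (range ⇑(ν i)) (range ⇑(ν j)))
    (hA : ∀ (K : Knot) (ν : Knot.TubularNbhd ⇑K),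
      ∃ g : HandleAttachingMap 3 2 (Metric.closedBall (0 : EuclideanSpace ℝ (Fin 4)) 1),
        ∀ y : ↥(handleTube 3 2),
          ((g.toFun y : Metric.closedBall (0 : EuclideanSpace ℝ (Fin 4)) 1) : EuclideanSpace ℝ (Fin 4)) =
            (1 - tubeDepth y / 4) •
              ((ν (tubeAngle y, tubeFibre y) : Metric.sphere (0 : EuclideanSpace ℝ (Fin 4)) 1) :
                EuclideanSpace ℝ (Fin 4)))
    (hB : ∀ (n : ℕ) (L : FramedLink (Fin n))
      (g : Fin n → HandleAttachingMap 3 2 (Metric.closedBall (0 : EuclideanSpace ℝ (Fin 4)) 1))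
      (ν : ∀ i, Knot.TubularNbhd ⇑(L.component i)),
      (∀ i, (ν i).HasFraming (L.framing i)) →
      (Pairwise fun i j => Disjoint (range ⇑(ν i)) (range ⇑(ν j))) →
      (∀ (i : Fin n) (y : ↥(handleTube 3 2)), tubeDepth y = 0 →
        (g i).toFun y = (closedBallBoundaryData 3).incl (ν i (tubeAngle y, tubeFibre y))) →
      ∀ (P : Type) [TopologicalSpace P] [ChartedSpace (EuclideanHalfSpace 4) P]
        [IsManifold (𝓡∂ 4) ((⊤ : ℕ∞) : WithTop ℕ∞) P],
        HandleAttachingMap.IsMultiAttachment g (𝓡∂ 4) P →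
          ∀ bP : BoundaryData (𝓡∂ 4) P (𝓡 3), L.IsSurgery (𝓡 3) bP.carrier)
    (hV : ∀ n : ℕ, ∃ (V : Type) (_ : TopologicalSpace V) (_ : T2Space V) (_ : SecondCountableTopology V)
      (_ : ChartedSpace (EuclideanHalfSpace 4) V) (_ : IsManifold (𝓡∂ 4) ((⊤ : ℕ∞) : WithTop ℕ∞) V)
      (_ : CompactSpace V) (_ : ConnectedSpace V) (bV : BoundaryData (𝓡∂ 4) V (𝓡 3)),
      HasHandleDecomposition 3 V (handleCount 1 n) ∧ IsOrientable (𝓡∂ 4) V ∧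
        IsSphereTwoProdCircleSum n bV.carrier)
    (hC : ∀ (n : ℕ) (L : FramedLink (Fin n))
      (g : Fin n → HandleAttachingMap 3 2 (Metric.closedBall (0 : EuclideanSpace ℝ (Fin 4)) 1))
      (ν : ∀ i, Knot.TubularNbhd ⇑(L.component i)),
      (∀ (i : Fin n) (y : ↥(handleTube 3 2)),
        (((g i).toFun y : Metric.closedBall (0 : EuclideanSpace ℝ (Fin 4)) 1) : EuclideanSpace ℝ (Fin 4)) =
          (1 - tubeDepth y / 4) •
            ((ν i (tubeAngle y, tubeFibre y) : Metric.sphere (0 : EuclideanSpace ℝ (Fin 4)) 1) :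
              EuclideanSpace ℝ (Fin 4))) →
      ∀ (P : Type) [TopologicalSpace P] [T2Space P] [ChartedSpace (EuclideanHalfSpace 4) P]
        [IsManifold (𝓡∂ 4) ((⊤ : ℕ∞) : WithTop ℕ∞) P],
        HandleAttachingMap.IsMultiAttachment g (𝓡∂ 4) P →
        ∀ (X : Type) [TopologicalSpace X] [T2Space X] [ChartedSpace (EuclideanSpace ℝ (Fin 4)) X]
          [IsManifold (𝓡 4) ((⊤ : ℕ∞) : WithTop ℕ∞) X] (j : P → X),
          Manifold.IsSmoothEmbedding (𝓡∂ 4) (𝓡 4) ((⊤ : ℕ∞) : WithTop ℕ∞) j →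
          ∀ i : Fin n, ∃ (e : EuclideanSpace ℝ (Fin 4) → X) (f : EuclideanSpace ℝ (Fin 2) → X),
            (L.component i).IsSliceDiscIn X e f) :
    ∀ (n : ℕ) (L : FramedLink (Fin n)) (Y : Type) [TopologicalSpace Y] [T2Space Y]
      [SecondCountableTopology Y] [ChartedSpace (EuclideanSpace ℝ (Fin 3)) Y]
      [IsManifold (𝓡 3) ((⊤ : ℕ∞) : WithTop ℕ∞) Y] [CompactSpace Y] [ConnectedSpace Y],
      IsSphereTwoProdCircleSum n Y → L.IsSurgery (𝓡 3) Y →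
        ∀ i : Fin n, (L.component i).IsHomotopyBallSlice := by
  intro n L Y _ _ _ _ _ _ _ hY hL i
  -- stub 1a: framed tubes with disjoint ranges; stub 1b: their radial attaching maps
  obtain ⟨ν, hfr, hνdisj⟩ := hT n L
  choose g hg using fun i => hA (L.component i) (ν i)
  have hbd := boundaryValues_of_radial (L := L) hg
  have hgdisj := pairwise_disjoint_range_of_radial (L := L) hνdisj hg
  -- attach the handles: a compact trace `P` of `L` (Kosinski VI §6, discharged)
  obtain ⟨P, _, _, _, hP2, hPσ, hPc, hP⟩ :=
    HandleAttachingMap.exists_isMultiAttachment_holds 3 2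
      (Metric.closedBall (0 : EuclideanSpace ℝ (Fin 4)) 1) (Fin n) g hgdisj
  haveI : T2Space P := hP2
  haveI : SecondCountableTopology P := hPσ
  haveI : CompactSpace P := hPc inferInstance
  have hPt : L.IsTrace P := isTrace_of_isMultiAttachment hfr hbd hP
  -- its canonical boundary datum `∂P`
  let bP : BoundaryData (𝓡∂ 4) P (𝓡 3) := BoundaryManifold.boundaryData 3 P
  haveI : T2Space bP.carrier := bP.t2Space_carrier
  haveI : SecondCountableTopology bP.carrier := bP.secondCountableTopology_carrier
  -- stub 2: `∂P` is a surgery on `L`; uniqueness of surgery: `Y ≅ ∂P`, so `∂P ≅ #ⁿ(S² × S¹)`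
  have hbP : L.IsSurgery (𝓡 3) bP.carrier := hB n L g ν hfr hνdisj hbd P hP bP
  obtain ⟨ψ⟩ := FramedLink.IsSurgery.nonempty_diffeomorph_holds hL hbP
  have hsum : IsSphereTwoProdCircleSum n bP.carrier := hY.of_diffeomorph ψ
  -- stub 3: `V ≅ ♮ⁿ S¹ × B³` with `∂V ≅ #ⁿ(S² × S¹) ≅ ∂P`
  obtain ⟨V, _, _, _, _, _, _, _, bV, hVh, hVo, hbV⟩ := hV n
  haveI : T2Space bV.carrier := bV.t2Space_carrier
  obtain ⟨φ⟩ := IsSphereTwoProdCircleSum.nonempty_diffeomorph n bP.carrier bV.carrier hsum hbV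
  -- glue `X = P ∪_φ V`: an R-link sphere, compact and `≃ₕ S⁴`
  obtain ⟨X, _, _, _, _, _, _, hX⟩ := exists_isBoundaryGluing_holds (n := 3) bP bV φ
  have hR : IsRLinkSphere X L := IsRLinkSphere.mk hPt hVh hVo hX
  haveI : CompactSpace X := hR.compactSpace
  -- stub 4: the core of the `i`-th handle, read in `X` through the gluing embedding `jP`
  obtain ⟨jP, jV, hjP, -, -, -⟩ := hX
  obtain ⟨e, f, hef⟩ := hC n L g ν hg P hP X jP hjP i
  exact hef.isHomotopyBallSlice (IsRLinkSphere.nonempty_homotopyEquiv_sphere_holds n L X hR)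

/-- **The crux modulo Kirby's sentence** (registered helper stub `helper_crux_of_kirbySentence`).  Granted the named fact
`exists_oneHandlebody_four_boundary_isSphereTwoProdCircleSum` (`OneHandlebodyBoundarySum.lean`:
for every `n` some compact connected orientable `(1,n)`-handlebody has some boundary datum which is
`#ⁿ(S² × S¹)` — Kirby 1989, Ch. I §2, p. 8; the registered stub `stub_oneHandlebody_boundary` is
this statement verbatim), the crux
`GompfScharlemannThompson2010_prop23` follows from
the four LANDED stubs through the sorry-free composition above.
[GompfScharlemannThompson2010, Prop. 2.3] [Kirby1989, Ch. I §2 (p. 8)]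
[folklore] -/
private theorem helper_crux_of_kirbySentence :
    Literature.Topology.FourManifolds.exists_oneHandlebody_four_boundary_isSphereTwoProdCircleSum →
      GompfScharlemannThompson2010_prop23 :=
  fun hK => isHomotopyBallSlice_of_stubs stub_exists_disjoint_framedTubes stub_attachingMap_of_tube
    stub_isSurgery_boundary_of_isMultiAttachment hK stub_core_isSliceDiscIn_of_isMultiAttachment

/-- **The crux modulo the one-handle step** (registered helper stub `helper_crux_of_step`).  Granted the named fact
`isConnectedSum_boundary_of_isHandleAttachment_one` (`OneHandlebodyBoundarySum.lean` §3: attaching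
one `1`-handle to a compact connected `4`-manifold with connected boundary changes the boundary by
`· # (S² × S¹)`; Kosinski VI §9, (6.6), (3.1)), Kirby's sentence holds
(`exists_oneHandlebody_four_boundary_isSphereTwoProdCircleSum_of_step`, PROVED there along the
UNIQ₄ induction vehicle), hence the crux. [Kosinski1993, VI §9] [Kirby1989, Ch. I §2 (p. 8)]
[folklore] -/
private theorem helper_crux_of_step :
    Literature.Topology.FourManifolds.isConnectedSum_boundary_of_isHandleAttachment_one →
      GompfScharlemannThompson2010_prop23 :=
  fun H => helper_crux_of_kirbySentence
    (exists_oneHandlebody_four_boundary_isSphereTwoProdCircleSum_of_step H)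

/-- **The crux modulo the `S⁰`-surgery lemma** (piece (2) of the roadmap of
`OneHandlebodyBoundarySum.lean`: `0`-surgery along a framed `S⁰` in a connected smooth `3`-manifold with
orientable result is a connected sum with `S² × S¹`; Kosinski VI §9 with (6.6), (3.1)): the one-handle
step follows from it (`isConnectedSum_boundary_of_isHandleAttachment_one_of_zeroSphereSurgery`, PROVED
from the landed piece (1) `IsHandleAttachment.exists_framedSphereFamily_isSurgery_boundary`), hence the
crux. [Kosinski1993, VI §9] [Kirby1989, Ch. I §2 (p. 8)]
[folklore] -/
private theorem helper_crux_of_zeroSphereSurgery :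
    (∀ (Z : Type) [TopologicalSpace Z] [T2Space Z] [ConnectedSpace Z]
      [ChartedSpace (EuclideanSpace ℝ (Fin 3)) Z] [IsManifold (𝓡 3) ((⊤ : ℕ∞) : WithTop ℕ∞) Z]
      (νS : Literature.Topology.FourManifolds.FramedSphereFamily (𝓡 3) Z Unit 0 3)
      (Z₂ : Type) [TopologicalSpace Z₂] [T2Space Z₂] [ChartedSpace (EuclideanSpace ℝ (Fin 3)) Z₂]
      [IsManifold (𝓡 3) ((⊤ : ℕ∞) : WithTop ℕ∞) Z₂],
      νS.IsSurgery (𝓡 3) Z₂ → Literature.Topology.FourManifolds.IsOrientable (𝓡 3) Z₂ →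
        Literature.Topology.FourManifolds.IsConnectedSum (𝓡 3) (𝓡 3) ((𝓡 2).prod (𝓡 1)) Z
          ((Metric.sphere (0 : EuclideanSpace ℝ (Fin 3)) 1) × (Metric.sphere (0 : EuclideanSpace ℝ (Fin 2)) 1)) Z₂) →
      GompfScharlemannThompson2010_prop23 :=
  fun H2 => helper_crux_of_kirbySentence
    (exists_oneHandlebody_four_boundary_isSphereTwoProdCircleSum_of_zeroSphereSurgery H2)

end Reduction

section Main

/-! ### Source `Summits/SmoothPoincare4/SmoothPoincare4/Theorems/VerlindeRLinksVrlComponentsHBallSlice.lean` — the closing file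

Original module docstring:

# Crux `VerlindeRLinks.VrlComponentsHBallSlice` (stmt-SmoothPoincare4-15874), line `kirby-lemma21`:
# every component of an R-link is slice in a homotopy `4`-ball — final assembly

The crux `Summit.SmoothPoincare4.SmoothPoincare4.Theses.VerlindeRLinks.VrlComponentsHBallSlice`
(Gompf–Scharlemann–Thompson 2010, Prop. 2.3 (Hillman), componentwise: every component of a framed
link `L ⊂ S³` whose surgery is `#ⁿ(S² × S¹)` is slice in a homotopy `4`-ball) follows from the
sorry-free composition of the line (`…Reduction.lean`, `helper_crux_of_zeroSphereSurgery`: the crux from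
the four landed stubs modulo the `S⁰`-surgery lemma — via Kirby's sentence
`∂(♮ⁿ S¹ × B³) = #ⁿ(S² × S¹)` (`OneHandlebodyBoundarySum.lean`, UNIQ₄ induction along one-handle
attachments) and the boundary of a one-handle attachment as a `0`-surgery along a framed `S⁰`
(`OneHandleAttachmentBoundarySurgery.lean`, `OneHandlebodyBoundarySumProofs.lean`)) and the now PROVED
`S⁰`-surgery lemma `FramedSphereFamily.isConnectedSum_sphereTwoProdCircle_of_isSurgery_of_isOrientable`
(`ZeroSphereSurgeryConnectedSum.lean`: `0`-surgery along a framed `S⁰` in a connected `3`-manifold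
with orientable result is `· # (S² × S¹)`; model `S² × S¹ ∖ pt`, standard discs, neck assembly,
disc-theorem normalisation and non-orientability of the twisted position).

## References

* R. E. Gompf, M. Scharlemann, A. Thompson, Geom. Topol. 14 (2010) 2305–2347, Prop. 2.3, §9.
  [GompfScharlemannThompson2010]
* R. C. Kirby, *The Topology of 4-Manifolds*, LNM 1374 (1989), Ch. I §2 (p. 8), Lemma 2.1. [Kirby1989]
* A. A. Kosinski, *Differential Manifolds* (1993), VI §6, §9. [Kosinski1993]
-/

open Literature.Topology.FourManifolds

end Main

end GompfScharlemannThompson2010Prop23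

/-! ### The named fact -/

section Fact

open GompfScharlemannThompson2010Prop23

/-- **Gompf–Scharlemann–Thompson 2010, Proposition 2.3 (Hillman), componentwise form — DISCHARGED**: if
surgery on a framed `n`-component link `L ⊂ S³` yields `#ⁿ(S² × S¹)`, then every component of `L` is slice in a
homotopy `4`-ball. The composition of line `kirby-lemma21` (`helper_crux_of_zeroSphereSurgery`) applied to the
`S⁰`-surgery lemma `FramedSphereFamily.isConnectedSum_sphereTwoProdCircle_of_isSurgery_of_isOrientable`.
[cite: GompfScharlemannThompson2010, Prop. 2.3] [cite: Kirby1989, Ch. I §2 (p. 8)] -/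
theorem GompfScharlemannThompson2010_prop23_holds : GompfScharlemannThompson2010_prop23 :=
  helper_crux_of_zeroSphereSurgery fun _ _ _ _ _ _ νS _ _ _ _ _ hS ho =>
    νS.isConnectedSum_sphereTwoProdCircle_of_isSurgery_of_isOrientable hS ho

end Fact

end Literature.Topology.FourManifolds

end
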